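import Literature.NumberTheory.Automorphic.GL2AdelicWeightVectors
import Literature.NumberTheory.Automorphic.AutomorphicRepsGLShiftRealisation
import Literature.NumberTheory.Automorphic.AutomorphicRepsGLCuspidalUnitaryHolds
import Literature.NumberTheory.Automorphic.AutomorphicRepsGL2WeightOneHeckeEigenform
import Literature.NumberTheory.Automorphic.NewformAdelisationDescentHolomorphy
import Literature.NumberTheory.Automorphic.GL2NewvectorExistence
import Literature.NumberTheory.Automorphic.ReciprocityGLnPotentialModularityTateProofs
import Literature.NumberTheory.Automorphic.EllipticCurveRatCuspidalRepProofs
import Literature.NumberTheory.Automorphic.AutomorphicRepsGLSatakeFlathProofs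
import Literature.NumberTheory.Automorphic.AutomorphicRepCentralCharacter
import Literature.NumberTheory.Automorphic.CuspFormsNoUnipotentArchInvariants
import Literature.NumberTheory.GaloisRepresentations.HeckeCharacterWeakApproximation
import Literature.NumberTheory.Automorphic.BCDTModularityModPProofs
import Literature.NumberTheory.EllipticCurves.Newforms
import Literature.NumberTheory.EllipticCurves.NewformsProofs
import Literature.NumberTheory.EllipticCurves.NewformsLiftProofs
import Literature.NumberTheory.EllipticCurves.MurtySinhaMultiplicityHeckeProofs
import Literature.NumberTheory.EllipticCurves.CuspFormLFunction
import Literature.NumberTheory.Automorphic.FLSModularityLiftingTheorem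
import Literature.NumberTheory.Automorphic.CDTTheorem722SerreProofs
import Literature.NumberTheory.EllipticCurves.IsogenyFrobeniusTraceHoldsProofs
import Literature.NumberTheory.EllipticCurves.LFunctionSmulProofs
import HarnessLib

/-!
# Stub-ideation k = 2, GENERATION 5 (home family 2 = RESHAPE) for `stub_liftFive` of crux
# `FreyModularity` (stmt-ABC-11340, route ABC/DefiniteXi, line `Lines/Sketch.lean`)

**Headline (kernel-checked, ZERO sorries, Literature-only imports): `d4a_holds : D4a`.**
The k = 2 lane (gen 3) reshaped `stub_liftFive` into Plan A (`FLS2015_theorem2` at `K = ℚ`,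
`p = 5`), kernel-checked in `STUB_IDEAS_stub_liftFive_2g3.lean` modulo ONE debt **D4a** — the
adelic-to-classical dictionary "a weight-zero cuspidal `π` on `GL₂(𝔸_ℚ)` carrying the Hecke
polynomials `X² - a_p(E) X + p` comes from a weight-`2` newform `g ∈ S₂(Γ₀(M))` with
`a_q(g) = a_q(E)` off a finite modulus" — and gen 4 ported the tree's weight-one dictionary to
weight two with NINE sorried helpers (P4a, P4b, P4, P5a–c, P6, P7, P8).  Generation 5 closes D4a:

* **§1 FIN(k) — strengthen-to-simplify (uniform weight `k`).** The finite side of the dictionary is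
  uniform in the weight (`heckeOperator_principalCongruenceLevel_adelicLiftFunA_one/two`, Flath,
  `CuspForm.eq_smul_of_adelicLiftFun_eq_smul`, Atkin–Lehner–Li `exists_isNewform1_of_eigenpacket`
  are stated for every `k : ℤ`): P5a/P5b/P5c PROVED for all `k` with the weight-`k` Satake
  dictionary `(√p)^{k-1}(α + β) = a_p`, `αβ = χ(p)` [Gelbart 1997, (2.5.1)].
* **§1 F5 — change the order (descend first, newform second).** D4a's consumer never uses
  `φ_g ∈ W`, so gen-4's minimal-level road P7 + P8 is replaced by: descend at Casselman's level
  `N`, take the newform `g₀` of the eigenpacket (`M₀ ∣ N`), read `χ = 1` off the Satake feed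
  `∏ α = 1` by Dirichlet, descend to `Γ₀(M₀)` (Murty–Sinha): `exists_isNewform0_of_adelicLiftFunA_mem_k`.
* **§2–§3 ARCH(2) — regime split.** The one genuinely weight-two statement is isolated as
  `DescentTwo` ⇐ `CuspFormOfFixedTwo` (gen-4 P6) ⇐ `RigidityTwo` (gen-4 P4), with the P6 port
  `cuspFormOfFixedTwo_of_rigidityTwo` PROVED here from the tree's weight-one twin
  `IsOfWeightOne.exists_cuspForm_of_fixed` (`1 ↦ 2`) and gen-4's PROVED P3/P3-ad (copied).
* **§2c NEW LEVER — P4 PROVED (`rigidityTwo_holds`).** A weight-`0` vector killed by `Z, X, X̄` is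
  killed by ALL of `𝔤𝔩₂(ℝ)` (`lieDeriv_toLie_eq_zero_of_killed`: `X + X̄ = 2h`, `X̄ - X = 2i(E₁₂+E₂₁)`,
  `W` acts by `i·0`), hence by the datum's square-zero directions at the real place
  (`Rat.lieDeriv_ofArch_lieOfReal_eq`, `Rat.realPlaceLie_eq_map`), and the TREE theorem
  `eq_zero_of_mem_cuspFormsGL_of_forall_lieDeriv_realPlace` (cusp forms on `GL_n`, `n ≥ 2`, have
  no vector annihilated by the nilpotent directions at one archimedean place: strong approximation
  + the cusp condition) finishes.  This replaces gen-4's P4a ("weight-0 functions killed by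
  `E₁₁, E₁₂` are constant on `GL₂(ℝ)⁺`") + P4b ("constants are not cuspidal") by one import.
* **§4 `d4a_holds`**, **§6 Plan A end to end**: gen-3's D4 with the sorry replaced, the CONGRUENCE
  form `liftFive_congruence_of_FLS2015_theorem2` (trust base {`FLS2015_theorem2`, ES, Carayol};
  gen-3's PROVED A1/D1/D2′ enter as verbatim hypotheses since crux-dir modules are not importable),
  and `sig_of_planA : … → WeightTwoRealisationFive → Sig` — D2 is now the ONLY non-named residual
  of Plan A for the stub AS TYPED; the congruence form (what case B of
  `isModular_freyCurve_of_stubs` actually has) has NONE.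
P0, P0′, P1 (pointwise), P2, P2′, P9 and the Arch layer are copied from gen 4 (PROVED there).
Nothing in this file is an `R = T` theorem; `FLS2015_theorem2` stays a named fact.
-/

-- Mathlib idiom (Mathlib/Algebra/Lie/OfAssociative.lean); needed to mention Lie subalgebras of matrix algebras
attribute [local instance 100] LieRing.ofAssociativeRing

set_option linter.dupNamespace false
set_option linter.unusedVariables false
set_option linter.unusedSectionVars false

noncomputable section

open scoped MatrixGroups Matrix NumberField ModularForm UpperHalfPlane Polynomial Classical
open NumberField NumberField.mixedEmbedding IsDedekindDomain Polynomial Filter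
open Literature.NumberTheory.Automorphic Literature.NumberTheory.GaloisRepresentations
open Literature.NumberTheory.EllipticCurves Literature.NumberTheory.EllipticCurves.ModularForms
open CongruenceSubgroup Rat.HeightOneSpectrum GL2Real AutomorphicRepData

namespace Summit.ABC.ABC.Cruxes.FreyModularity.StubIdeas.LiftFive2g5

attribute [local instance] neZero_natGenerator

/-! ## §0  The target (verbatim) and the weight-two parameter -/

/-- **D4a verbatim** (gen-3 `exists_isNewform0_of_isAutomorphicOfWeightZero_rat`, gen-4 `D4a`). -/
def D4a : Prop :=
  ∀ (E : WeierstrassCurve (𝓞 ℚ)), E.Δ ≠ 0 → IsAutomorphicOfWeightZero E →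
    ∃ (M : ℕ) (_ : NeZero M) (g : CuspForm (Gamma0 M) 2), IsNewform0 g ∧
      ∃ (R : ℕ) (_ : NeZero R), ∀ q : ℕ, q.Prime → ¬ q ∣ M * R →
        cuspCoeff g q = ((E.baseChange ℚ).LFunction q : ℂ)

/-- `s₁ = (k-1)/2`, `k = 2`, in the syntactic form of `map_a_weightZeroInfinityType_two`. -/
def sOne : ℂ := (((2 : ℤ) : ℂ) - 1) / 2

/-- `s₂ = (1-k)/2`, `k = 2`. -/
def sTwo : ℂ := (1 - ((2 : ℤ) : ℂ)) / 2

/-- `s₁ + s₂ = 0`. -/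
theorem sOne_add_sTwo : sOne + sTwo = 0 := by
  unfold sOne sTwo; push_cast; ring

/-- `s₁² + s₂² - ½ = 0` (`C = 0`, hence Casimir `Ω = 0`: the infinitesimal character of `D₂`). -/
theorem sOne_sq_add_sTwo_sq : sOne ^ 2 + sTwo ^ 2 - 1 / 2 = 0 := by
  unfold sOne sTwo; push_cast; ring

/-! ## §1  FIN(k): the finite side of the dictionary `π ↦ f_π`, uniform in the weight `k`

Ports of the PROVED `k = 1` theorems of `AutomorphicRepsGL2WeightOneHeckeEigenform` with `1 ↦ k`;
the only change is the archimedean factor `((√p)^(k-2))⁻¹` of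
`heckeOperator_principalCongruenceLevel_adelicLiftFunA_one`, which is `√p` at `k = 1` and `1` at
`k = 2`. -/

section Fin

variable {hcpt : isCompact_glFiniteIntegralLevel 2 ℚ} {π : AutomorphicRepData (AutomorphyDatum.gl 2 ℚ hcpt)}
  {N : ℕ} [NeZero N] {k : ℤ}

omit [NeZero N] in
/-- `a • f = b • f` with `f ≠ 0` forces `a = b` (any weight). [folklore] -/
theorem smul_left_cancel_of_ne_zero_k {f : CuspForm (Gamma1 N) k} (hf0 : f ≠ 0) {a b : ℂ}
    (h : a • f = b • f) : a = b := by
  by_contra hab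
  have h' : (a - b) • f = 0 := by rw [sub_smul, h, sub_self]
  exact hf0 ((smul_eq_zero.mp h').resolve_left (sub_ne_zero.mpr hab))

/-- `(s^(k-2))⁻¹ a = s^{1·(2-1)} · ((s^(k-1))⁻¹ a)` — the weight-`k` bookkeeping between Gelbart's
Lemma 3.7 (`T_{p,1} φ_f = (√p)^{2-k} φ_{T_p f}`) and the normalisation `q^{i(n-i)/2} e_i` of
`HasSatakeParamAt` (`i = 1`, `n = 2`). [folklore] -/
theorem zpow_bookkeeping {s : ℂ} (hs : s ≠ 0) (k : ℤ) (a : ℂ) :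
    (s ^ (k - 2))⁻¹ * a = s ^ (1 * (2 - 1)) * ((s ^ (k - 1))⁻¹ * a) := by
  have h : s ^ (k - 1) = s ^ (k - 2) * s := by
    rw [show k - 1 = k - 2 + 1 by ring, zpow_add_one₀ hs]
  have h2 : s ^ (k - 2) ≠ 0 := zpow_ne_zero _ hs
  rw [h, mul_inv, Nat.one_mul, show (2 - 1 : ℕ) = 1 from rfl, pow_one]
  field_simp

/-- **F1 (= P5a, all weights; PROVED).** `φ_f ∈ W` (`π = W/⊥`) makes `f ∈ S_k(Γ₁(N))` a `T_p`- and
`⟨p⟩`-eigenform at `p ∤ N`, with the adelic eigenvalue equations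
`T_{p,1} φ_f = (√p)^{2-k} a_p φ_f`, `T_{p,2} φ_f = e_p φ_f` (Gelbart 1975, Lemma 3.7; Gelbart 1997,
Prop. 2.5 (b), (2.5.1) `p^{(k-1)/2}(μ₁(p) + μ₂(p)) = a_p`). Port of
`exists_heckeT_eq_smul_of_adelicLiftFunA_mem` (`1 ↦ k`). [cite: Gelbart1975, Lemma 3.7]
[cite: Gelbart1997, Prop. 2.5 (b), (2.5.1)] -/
theorem exists_heckeT_eq_smul_of_adelicLiftFunA_mem_k (hbot : π.W' = ⊥) (f : CuspForm (Gamma1 N) k)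
    (hfW : adelicLiftFunA N k f ∈ π.W) {v : HeightOneSpectrum (𝓞 ℚ)} (hv : ¬ v.asIdeal ∣ Ideal.span {(N : 𝓞 ℚ)}) :
    ∃ a e : ℂ, ModularForms.heckeT (Gamma1 N) k (natGenerator v) f = a • f ∧
      diamondOp N k ((natGenerator v : ℕ) : ZMod N) f = e • f ∧
      heckeOperator (rightTranslation (AdelicGroupData.gl 2 ℚ))
          (show Subgroup (AdelicGroupData.gl 2 ℚ).Adelic from principalCongruenceLevel 2 ℚ (Ideal.span {(N : 𝓞 ℚ)}))
          (heckeDiagAt 2 ℚ v (Rat.localUniformizer v) 1) (adelicLiftFunA N k f) =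
        (((((Real.sqrt (natGenerator v) : ℝ) : ℂ)) ^ (k - 2))⁻¹ * a) • adelicLiftFunA N k f ∧
      heckeOperator (rightTranslation (AdelicGroupData.gl 2 ℚ))
          (show Subgroup (AdelicGroupData.gl 2 ℚ).Adelic from principalCongruenceLevel 2 ℚ (Ideal.span {(N : 𝓞 ℚ)}))
          (heckeDiagAt 2 ℚ v (Rat.localUniformizer v) 2) (adelicLiftFunA N k f) = e • adelicLiftFunA N k f := by
  have h𝔫 : (Ideal.span {(N : 𝓞 ℚ)} : Ideal (𝓞 ℚ)) ≠ 0 := Rat.span_natCast_ne_zero N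
  have hfixmem := adelicLiftFunA_mem_fixedPoints_principalCongruenceLevel (k := k) f
  have hfix : ∀ u ∈ principalCongruenceLevel 2 ℚ (Ideal.span {(N : 𝓞 ℚ)}),
      rightTranslation (AdelicGroupData.gl 2 ℚ) u (adelicLiftFunA N k f) = adelicLiftFunA N k f := fun u hu =>
    ((rightTranslation (AdelicGroupData.gl 2 ℚ)).mem_fixedPoints _ (adelicLiftFunA N k f)).1 hfixmem u hu
  -- the scalars of Flath's theorem, exact since `W' = ⊥`
  have hscalar : ∀ i : ℕ, ∃ c : ℂ, heckeOperator (rightTranslation (AdelicGroupData.gl 2 ℚ))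
      (show Subgroup (AdelicGroupData.gl 2 ℚ).Adelic from principalCongruenceLevel 2 ℚ (Ideal.span {(N : 𝓞 ℚ)}))
      (heckeDiagAt 2 ℚ v (Rat.localUniformizer v) i) (adelicLiftFunA N k f) = c • adelicLiftFunA N k f := by
    intro i
    obtain ⟨c, hc⟩ := π.Flath1979_heckeOperator_ofLocal_sub_smul_mem_holds v
      (glDiagonal 2 (v.adicCompletion ℚ) fun j => if (j : ℕ) < i then Rat.localUniformizer v else 1)
    have h := hc h𝔫 hv (adelicLiftFunA N k f) hfW hfix
    rw [← heckeDiagAt_eq_ofLocal_glDiagonal, hbot, Submodule.mem_bot, sub_eq_zero] at h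
    exact ⟨c, h⟩
  obtain ⟨c₁, hc₁⟩ := hscalar 1
  obtain ⟨c₂, hc₂⟩ := hscalar 2
  -- the lift identities (Gelbart 1975, Lemma 3.7), valid for every weight `k`
  have L₁ := heckeOperator_principalCongruenceLevel_adelicLiftFunA_one (k := k) f hv
  have L₂ := heckeOperator_principalCongruenceLevel_adelicLiftFunA_two (k := k) f hv
  have hs0 : ((Real.sqrt (natGenerator v) : ℝ) : ℂ) ≠ 0 := by
    exact_mod_cast (Real.sqrt_pos.2 (Nat.cast_pos.2 (prime_natGenerator v).pos)).ne'
  have hsk : ((Real.sqrt (natGenerator v) : ℝ) : ℂ) ^ (k - 2) ≠ 0 := zpow_ne_zero _ hs0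
  -- `φ_{T_p f} = ((√p)^(k-2) c₁) φ_f`, `φ_{⟨p⟩ f} = c₂ φ_f`
  have E₁ : adelicLiftFunA N k (ModularForms.heckeT (Gamma1 N) k (natGenerator v) f) =
      ((((Real.sqrt (natGenerator v) : ℝ) : ℂ)) ^ (k - 2) * c₁) • adelicLiftFunA N k f := by
    rw [mul_smul, ← hc₁, L₁, smul_inv_smul₀ hsk]
  have E₂ : adelicLiftFunA N k (diamondOp N k ((natGenerator v : ℕ) : ZMod N) f) = c₂ • adelicLiftFunA N k f := by
    rw [← L₂, hc₂]
  refine ⟨(((Real.sqrt (natGenerator v) : ℝ) : ℂ)) ^ (k - 2) * c₁, c₂, CuspForm.eq_smul_of_adelicLiftFun_eq_smul E₁,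
    CuspForm.eq_smul_of_adelicLiftFun_eq_smul E₂, ?_, hc₂⟩
  rw [hc₁, ← mul_assoc, inv_mul_cancel₀ hsk, one_mul]

/-- **F2 (= P5b, all weights; PROVED).** `f ∈ S_k(N, χ)` for some Dirichlet character `χ` when
`f ≠ 0`, `φ_f ∈ W`, `π = W/⊥` (Dirichlet `Nat.forall_exists_prime_gt_and_eq_mod`, `diamondOp_mul_holds`).
Port of `exists_mem_nebentypusSubspace_of_adelicLiftFunA_mem`. [cite: DiamondShurman2005, §5.2 p. 169] -/
theorem exists_mem_nebentypusSubspace_of_adelicLiftFunA_mem_k (hbot : π.W' = ⊥) {f : CuspForm (Gamma1 N) k}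
    (hf0 : f ≠ 0) (hfW : adelicLiftFunA N k f ∈ π.W) :
    ∃ χ : DirichletCharacter ℂ N, f ∈ nebentypusSubspace N k χ := by
  have hD : ∀ d : (ZMod N)ˣ, ∃ c : ℂ, diamondOp N k (d : ZMod N) f = c • f := by
    intro d
    obtain ⟨p, -, hp, hpd⟩ := Nat.forall_exists_prime_gt_and_eq_mod (Units.isUnit d) 0
    have hpN : ¬ p ∣ N := (ZMod.isUnit_prime_iff_not_dvd hp).1 (hpd ▸ Units.isUnit d)
    set v : HeightOneSpectrum (𝓞 ℚ) := (primesEquiv (R := 𝓞 ℚ)).symm ⟨p, hp⟩ with hvdef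
    have hvp : natGenerator v = p := natGenerator_primesEquiv_symm' ⟨p, hp⟩
    have hv : ¬ v.asIdeal ∣ Ideal.span {(N : 𝓞 ℚ)} := fun h => hpN (hvp ▸ (Rat.natGenerator_dvd_iff v N).2 h)
    obtain ⟨-, e, -, he, -, -⟩ := exists_heckeT_eq_smul_of_adelicLiftFunA_mem_k hbot f hfW hv
    refine ⟨e, ?_⟩
    rw [← hpd, ← hvp]
    exact he
  choose c hc using hD
  have hsmul : ∀ {a b : ℂ}, a • f = b • f → a = b := fun {a b} h => smul_left_cancel_of_ne_zero_k hf0 h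
  have hone : c 1 = 1 := hsmul (by
    rw [← hc 1, Units.val_one, ModularForms.diamondOp_one_apply, one_smul])
  have hmul : ∀ d e, c (d * e) = c d * c e := fun d e => hsmul (by
    rw [← hc (d * e), Units.val_mul, diamondOp_mul_holds N k d.isUnit e.isUnit, Module.End.mul_apply, hc e,
      map_smul, hc d, smul_smul, mul_comm])
  have hne : ∀ d, c d ≠ 0 := fun d h0 => by
    have h := hmul d d⁻¹
    rw [mul_inv_cancel, hone, h0, zero_mul] at h
    exact one_ne_zero h
  let θ : (ZMod N)ˣ →* ℂˣ :=
    { toFun := fun d => Units.mk0 (c d) (hne d)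
      map_one' := Units.ext hone
      map_mul' := fun d e => Units.ext (hmul d e) }
  refine ⟨MulChar.ofUnitHom θ, ?_⟩
  rw [nebentypusSubspace, Submodule.mem_iInf]
  intro d
  rw [LinearMap.mem_ker, LinearMap.sub_apply, LinearMap.smul_apply, LinearMap.id_apply, MulChar.ofUnitHom_coe, hc d,
    sub_eq_zero]
  rfl

/-- **F3 (= P5c, all weights; PROVED).** The Satake parameter of `π` at `p ∤ N` read off
`T_p f = a f`, `⟨p⟩ f = e f` (`f ≠ 0`, `φ_f ∈ W`, `W' = ⊥`): `π` has at `v ∣ p` the Satake parameter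
`{α, β}` with `(X - α)(X - β) = X² - (√p)^{1-k} a X + e` (Gelbart 1997, (2.5.1):
`p^{(k-1)/2}(μ₁(p) + μ₂(p)) = a_p`, `ψ(p) = μ₁(p) μ₂(p)`; the witness is `φ_f`). Port of
`hasSatakeParamAt_of_adelicLiftFunA_mem`. [cite: Gelbart1997, Prop. 2.5 (b), (2.5.1) and Corollary] -/
theorem hasSatakeParamAt_of_adelicLiftFunA_mem_k (hbot : π.W' = ⊥) {f : CuspForm (Gamma1 N) k} (hf0 : f ≠ 0)
    (hfW : adelicLiftFunA N k f ∈ π.W) {v : HeightOneSpectrum (𝓞 ℚ)} (hv : ¬ v.asIdeal ∣ Ideal.span {(N : 𝓞 ℚ)})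
    {a e : ℂ} (hT : ModularForms.heckeT (Gamma1 N) k (natGenerator v) f = a • f)
    (hD : diamondOp N k ((natGenerator v : ℕ) : ZMod N) f = e • f) :
    ∃ α : Multiset ℂ, π.HasSatakeParamAt v α ∧
      satakePolynomial α = X ^ 2 - C (((((Real.sqrt (natGenerator v) : ℝ) : ℂ)) ^ (k - 1))⁻¹ * a) * X + C e := by
  have h𝔫 : (Ideal.span {(N : 𝓞 ℚ)} : Ideal (𝓞 ℚ)) ≠ 0 := Rat.span_natCast_ne_zero N
  obtain ⟨a', e', hT', hD', h₁, h₂⟩ := exists_heckeT_eq_smul_of_adelicLiftFunA_mem_k hbot f hfW hv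
  have ha : a' = a := smul_left_cancel_of_ne_zero_k hf0 (hT'.symm.trans hT)
  have he : e' = e := smul_left_cancel_of_ne_zero_k hf0 (hD'.symm.trans hD)
  subst ha he
  have hfixmem := adelicLiftFunA_mem_fixedPoints_principalCongruenceLevel (k := k) f
  have hfix : ∀ u ∈ principalCongruenceLevel 2 ℚ (Ideal.span {(N : 𝓞 ℚ)}),
      rightTranslation (AdelicGroupData.gl 2 ℚ) u (adelicLiftFunA N k f) = (adelicLiftFunA N k f) := fun u hu =>
    ((rightTranslation (AdelicGroupData.gl 2 ℚ)).mem_fixedPoints _ (adelicLiftFunA N k f)).1 hfixmem u hu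
  have hφ0 : (adelicLiftFunA N k f) ≠ 0 := by
    intro h0
    apply hf0
    have h1 : adelicLiftFun N k ⇑f = (0 : ℂ) • adelicLiftFun N k ⇑f := by
      rw [zero_smul]; exact h0
    have := CuspForm.eq_smul_of_adelicLiftFun_eq_smul h1
    rwa [zero_smul] at this
  have hs0 : ((Real.sqrt (natGenerator v) : ℝ) : ℂ) ≠ 0 := by
    exact_mod_cast (Real.sqrt_pos.2 (Nat.cast_pos.2 (prime_natGenerator v).pos)).ne'
  -- the multiset with `e₀ = 1`, `e₁ = (√p)^{1-k} a'`, `e₂ = e'`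
  obtain ⟨α, hcard, hα⟩ := exists_multiset_esymm_eq 2
    (fun i => if i = 0 then (1 : ℂ) else if i = 1 then
      ((((Real.sqrt (natGenerator v) : ℝ) : ℂ)) ^ (k - 1))⁻¹ * a' else e') (if_pos rfl)
  have hα0 : α.esymm 0 = 1 := by rw [hα 0 (by norm_num)]; rfl
  have hα1 : α.esymm 1 = ((((Real.sqrt (natGenerator v) : ℝ) : ℂ)) ^ (k - 1))⁻¹ * a' := by
    rw [hα 1 (by norm_num)]; rfl
  have hα2 : α.esymm 2 = e' := by rw [hα 2 le_rfl]; rfl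
  refine ⟨α, ⟨Ideal.span {(N : 𝓞 ℚ)}, Rat.localUniformizer v, h𝔫, hv, Rat.valued_localUniformizer v, hcard,
    (adelicLiftFunA N k f), hfW, ?_, hfix, fun i hi => ?_⟩, by rw [satakePolynomial_eq_of_card_eq_two hcard hα0, hα1, hα2]⟩
  · rw [hbot]
    exact fun h => hφ0 ((Submodule.mem_bot ℂ).1 h)
  · rw [hbot, Submodule.mem_bot, sub_eq_zero, Rat.residueCard_eq_natGenerator]
    interval_cases i
    · -- `T_{v,0} = 1`
      rw [heckeDiagAt_zero, hα0, Nat.zero_mul, pow_zero, one_mul, one_smul]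
      exact heckeOperator_one_apply _ _ hfixmem
    · rw [hα1, h₁, zpow_bookkeeping hs0 k a']
    · rw [hα2]
      simpa using h₂

/-- **F3′ (all weights; PROVED) — the same in the shape `(√p)^{k-1}(α + β) = a`, `αβ = e`.**
[cite: Gelbart1997, (2.5.1)] -/
theorem hasSatakeParamAt_sum_prod_of_adelicLiftFunA_mem_k (hbot : π.W' = ⊥) {f : CuspForm (Gamma1 N) k}
    (hf0 : f ≠ 0) (hfW : adelicLiftFunA N k f ∈ π.W) {v : HeightOneSpectrum (𝓞 ℚ)}
    (hv : ¬ v.asIdeal ∣ Ideal.span {(N : 𝓞 ℚ)}) {a e : ℂ}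
    (hT : ModularForms.heckeT (Gamma1 N) k (natGenerator v) f = a • f)
    (hD : diamondOp N k ((natGenerator v : ℕ) : ZMod N) f = e • f) :
    ∃ α : Multiset ℂ, π.HasSatakeParamAt v α ∧
      (((Real.sqrt (natGenerator v) : ℝ) : ℂ)) ^ (k - 1) * α.sum = a ∧ α.prod = e := by
  obtain ⟨α, hα, hpoly⟩ := hasSatakeParamAt_of_adelicLiftFunA_mem_k hbot hf0 hfW hv hT hD
  refine ⟨α, hα, ?_⟩
  have hs0 : ((Real.sqrt (natGenerator v) : ℝ) : ℂ) ≠ 0 := by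
    exact_mod_cast (Real.sqrt_pos.2 (Nat.cast_pos.2 (prime_natGenerator v).pos)).ne'
  have hsk : ((Real.sqrt (natGenerator v) : ℝ) : ℂ) ^ (k - 1) ≠ 0 := zpow_ne_zero _ hs0
  obtain ⟨z₁, z₂, rfl⟩ := Multiset.card_eq_two.1 hα.card_eq
  have hpoly' : (X : ℂ[X]) ^ 2 - C (z₁ + z₂) * X + C (z₁ * z₂) =
      X ^ 2 - C (((((Real.sqrt (natGenerator v) : ℝ) : ℂ)) ^ (k - 1))⁻¹ * a) * X + C e := by
    rw [← hpoly, satakePolynomial, Multiset.insert_eq_cons, Multiset.map_cons, Multiset.prod_cons,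
      Multiset.map_singleton, Multiset.prod_singleton, map_add, map_mul]
    ring
  obtain ⟨hsum, hprod⟩ := coeff_quadratic_eq hpoly'
  refine ⟨?_, ?_⟩
  · rw [Multiset.insert_eq_cons, Multiset.sum_cons, Multiset.sum_singleton, hsum, mul_inv_cancel_left₀ hsk]
  · rw [Multiset.insert_eq_cons, Multiset.prod_cons, Multiset.prod_singleton, hprod]

/-- **F4 (all weights; PROVED) — the newform of the eigenpacket computes the Satake parameters of
`π` off `N`.** `f ∈ S_k(N, χ)` (F2) is an eigenform off `N` (F1); its packet is the packet of a
newform `g₀ ∈ S_k(Γ₁(M₀))`, `M₀ ∣ N`, whose nebentypus induces `χ` (Atkin–Lehner–Li,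
`exists_isNewform1_of_eigenpacket`); and F3′. Port of `exists_isNewform1_satake_of_adelicLiftFunA_mem`
(`1 ↦ k`), conclusion in the weight-`k` shape `(√p)^{k-1} Σα = a_p(g₀)`, `∏α = χ(p)`.
[cite: Gelbart1997, Prop. 2.5 and Corollary] [cite: DiamondShurman2005, Thm. 5.8.2–5.8.3] -/
theorem exists_isNewform1_satake_of_adelicLiftFunA_mem_k (hbot : π.W' = ⊥) {f : CuspForm (Gamma1 N) k}
    (hf0 : f ≠ 0) (hfW : adelicLiftFunA N k f ∈ π.W) :
    ∃ (χ : DirichletCharacter ℂ N) (M₀ : ℕ) (_ : NeZero M₀) (hM₀ : M₀ ∣ N) (g₀ : CuspForm (Gamma1 M₀) k),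
      IsNewform1 g₀ ∧ DirichletCharacter.changeLevel hM₀ (nebentypus g₀) = χ ∧
      ∀ v : HeightOneSpectrum (𝓞 ℚ), ¬ natGenerator v ∣ N →
        ∃ α : Multiset ℂ, π.HasSatakeParamAt v α ∧
          (((Real.sqrt (natGenerator v) : ℝ) : ℂ)) ^ (k - 1) * α.sum = cuspCoeff g₀ (natGenerator v) ∧
          α.prod = χ ((natGenerator v : ℕ) : ZMod N) := by
  classical
  obtain ⟨χ, hfχ⟩ := exists_mem_nebentypusSubspace_of_adelicLiftFunA_mem_k hbot hf0 hfW
  have hTv : ∀ v : HeightOneSpectrum (𝓞 ℚ), ¬ v.asIdeal ∣ Ideal.span {(N : 𝓞 ℚ)} →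
      ∃ a : ℂ, ModularForms.heckeT (Gamma1 N) k (natGenerator v) f = a • f := fun v hv => by
    obtain ⟨a, -, ha, -⟩ := exists_heckeT_eq_smul_of_adelicLiftFunA_mem_k hbot f hfW hv
    exact ⟨a, ha⟩
  have hvN : ∀ v : HeightOneSpectrum (𝓞 ℚ), ¬ natGenerator v ∣ N → ¬ v.asIdeal ∣ Ideal.span {(N : 𝓞 ℚ)} :=
    fun v h hv => h ((Rat.natGenerator_dvd_iff v N).2 hv)
  have hTp : ∀ (p : ℕ) (hp : p.Prime), ¬ p ∣ N →
      ∃ a : ℂ, (haveI : NeZero p := ⟨hp.ne_zero⟩; ModularForms.heckeT (Gamma1 N) k p f) = a • f := by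
    intro p hp hpN
    set v : HeightOneSpectrum (𝓞 ℚ) := (primesEquiv (R := 𝓞 ℚ)).symm ⟨p, hp⟩ with hvdef
    have hvp : natGenerator v = p := natGenerator_primesEquiv_symm' ⟨p, hp⟩
    obtain ⟨a, ha⟩ := hTv v (hvN v (by rw [hvp]; exact hpN))
    refine ⟨a, ?_⟩
    have gen : ∀ (q : ℕ) (hq : NeZero q), q = p →
        (haveI := hq; ModularForms.heckeT (Gamma1 N) k q f) = a • f →
          (haveI : NeZero p := ⟨hp.ne_zero⟩; ModularForms.heckeT (Gamma1 N) k p f) = a • f := by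
      rintro q hq rfl h; exact h
    exact gen (natGenerator v) inferInstance hvp ha
  let a : ℕ → ℂ := fun p => if h : p.Prime ∧ ¬ p ∣ N then Classical.choose (hTp p h.1 h.2) else 0
  have hT : ∀ (p : ℕ) (hp : p.Prime), ¬ p ∣ N →
      (haveI : NeZero p := ⟨hp.ne_zero⟩; ModularForms.heckeT (Gamma1 N) k p f) = a p • f := by
    intro p hp hpN
    have hdef : a p = Classical.choose (hTp p hp hpN) := dif_pos ⟨hp, hpN⟩
    rw [hdef]
    exact Classical.choose_spec (hTp p hp hpN)
  obtain ⟨M₀, hM₀0, hM₀, g₀, hg₀, hcoeff, hχ⟩ := exists_isNewform1_of_eigenpacket hf0 hfχ hT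
  refine ⟨χ, M₀, hM₀0, hM₀, g₀, hg₀, hχ, fun v hvN' => ?_⟩
  have hv := hvN v hvN'
  obtain ⟨u, hu⟩ := ZMod.isUnit_prime_of_not_dvd (prime_natGenerator v) hvN'
  have hD : diamondOp N k ((natGenerator v : ℕ) : ZMod N) f = χ ((natGenerator v : ℕ) : ZMod N) • f := by
    rw [← hu]
    exact (mem_nebentypusSubspace_iff_diamondOp.mp hfχ) u
  obtain ⟨α, hsat, hsum, hprod⟩ := hasSatakeParamAt_sum_prod_of_adelicLiftFunA_mem_k hbot hf0 hfW hv
    (hT _ (prime_natGenerator v) hvN') hD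
  exact ⟨α, hsat, by rw [hsum, hcoeff _ (prime_natGenerator v) hvN'], hprod⟩

/-- The `Γ₁(M)`-lift of a `Γ₀(M)`-form has the same Fourier coefficients (`coe_liftToGamma1_holds`;
copy of `cuspCoeff_liftToGamma1_eq`, whose home file has a heavy import closure). [folklore] -/
theorem cuspCoeff_liftToGamma1_eq' {M : ℕ} [NeZero M] (g : CuspForm (Gamma0 M) k) (n : ℕ) :
    cuspCoeff (liftToGamma1 M k g) n = cuspCoeff g n := by
  unfold cuspCoeff
  rw [coe_liftToGamma1_holds M k g]

/-- **F5 (all weights; PROVED) — descend first, Atkin–Lehner–Li second: the `Γ₀`-newform of the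
eigenpacket and its `a_p` off `N · R`.** If `f ∈ S_k(Γ₁(N))`, `f ≠ 0`, `φ_f ∈ W` (`W' = ⊥`), and
every Satake parameter `α_v` of `π` at `v` with `p_v ∤ R` (`R ≥ 1`) has `∏ α_v = 1`,
`(√p_v)^{k-1} Σ α_v = a v`, then there are `M₀ ∣ N` and a newform `g ∈ S_k(Γ₀(M₀))` with
`a_{p_v}(g) = a v` whenever `p_v ∤ N R`: by F4 and the feed, `χ(p) = 1` for every prime `p ∤ N R`,
so `χ = 1` (Dirichlet: every unit class mod `N` contains a prime `p > R`), the nebentypus of `g₀` is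
trivial (`changeLevel_eq_one_iff`), `g₀ = liftToGamma1 g` with `g` a `Γ₀(M₀)`-newform
(Murty–Sinha `exists_liftToGamma1_eq_of_mem_nebentypusSubspace_one`, `isNewform1_liftToGamma1_iff`),
and `a_p(g) = a_p(g₀) = (√p)^{k-1} Σ α = a v`. Replaces gen-4 P7 + P8; no minimal level.
[cite: DiamondShurman2005, §4.3 p. 119 and Thm. 5.8.2] [cite: AtkinLehner1970, Thm. 3] -/
theorem exists_isNewform0_of_adelicLiftFunA_mem_k (hbot : π.W' = ⊥) {f : CuspForm (Gamma1 N) k}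
    (hf0 : f ≠ 0) (hfW : adelicLiftFunA N k f ∈ π.W) {R : ℕ} (hR : R ≠ 0)
    (a : HeightOneSpectrum (𝓞 ℚ) → ℂ)
    (hfeed : ∀ v : HeightOneSpectrum (𝓞 ℚ), ¬ natGenerator v ∣ R → ∀ α : Multiset ℂ,
      π.HasSatakeParamAt v α → α.prod = 1 ∧
        (((Real.sqrt (natGenerator v) : ℝ) : ℂ)) ^ (k - 1) * α.sum = a v) :
    ∃ (M₀ : ℕ) (_ : NeZero M₀) (_ : M₀ ∣ N) (g : CuspForm (Gamma0 M₀) k), IsNewform0 g ∧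
      ∀ v : HeightOneSpectrum (𝓞 ℚ), ¬ natGenerator v ∣ N * R → cuspCoeff g (natGenerator v) = a v := by
  obtain ⟨χ, M₀, hM₀0, hM₀, g₀, hg₀, hχ, hsat⟩ := exists_isNewform1_satake_of_adelicLiftFunA_mem_k hbot hf0 hfW
  -- `χ = 1`: every unit class mod `N` contains a prime `p > R` (so `p ∤ R`, `p ∤ N`)
  have hχ1 : χ = 1 := by
    refine MulChar.ext fun u => ?_
    rw [MulChar.one_apply_coe]
    obtain ⟨p, hpR, hp, hpu⟩ := Nat.forall_exists_prime_gt_and_eq_mod (Units.isUnit u) R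
    have hpN : ¬ p ∣ N := (ZMod.isUnit_prime_iff_not_dvd hp).1 (hpu ▸ Units.isUnit u)
    have hpR' : ¬ p ∣ R := fun h => absurd hpR (not_lt.2 (Nat.le_of_dvd (Nat.pos_of_ne_zero hR) h))
    set v : HeightOneSpectrum (𝓞 ℚ) := (primesEquiv (R := 𝓞 ℚ)).symm ⟨p, hp⟩ with hvdef
    have hvp : natGenerator v = p := natGenerator_primesEquiv_symm' ⟨p, hp⟩
    obtain ⟨α, hα, -, hprod⟩ := hsat v (by rw [hvp]; exact hpN)
    obtain ⟨hprod1, -⟩ := hfeed v (by rw [hvp]; exact hpR') α hα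
    have h1 : χ ((natGenerator v : ℕ) : ZMod N) = 1 := by rw [← hprod, hprod1]
    rwa [hvp, hpu] at h1
  have hneb : nebentypus g₀ = 1 := (DirichletCharacter.changeLevel_eq_one_iff hM₀).1 (hχ.trans hχ1)
  have hmem : g₀ ∈ nebentypusSubspace M₀ k 1 := hneb ▸ IsNewform1.mem_nebentypusSubspace_nebentypus_holds hg₀
  obtain ⟨g, hg⟩ := MurtySinha.exists_liftToGamma1_eq_of_mem_nebentypusSubspace_one M₀ k hmem
  have hg0 : IsNewform0 g := (isNewform1_liftToGamma1_iff_holds M₀ k g).1 (by rw [hg]; exact hg₀)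
  refine ⟨M₀, hM₀0, hM₀, g, hg0, fun v hv => ?_⟩
  have hvN : ¬ natGenerator v ∣ N := fun h => hv (dvd_mul_of_dvd_left h R)
  have hvR : ¬ natGenerator v ∣ R := fun h => hv (dvd_mul_of_dvd_right h N)
  obtain ⟨α, hα, hsum, -⟩ := hsat v hvN
  obtain ⟨-, hsum'⟩ := hfeed v hvR α hα
  rw [← cuspCoeff_liftToGamma1_eq' g, hg, ← hsum, hsum']

end Fin

/-! ## §2  ARCH(2): the one residual statement, and its derivation from gen-4's P6 -/

/-- **ARCH(2) = `DescentTwo` (the residual debt of Plan A after gen 5).** A `K₁(N)`-fixed non-zero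
vector `φ` of a clean (`W' = ⊥`) automorphic representation `π` of `GL₂(𝔸_ℚ)` realised on cusp
forms, with Harish-Chandra parameter `{1/2, -1/2}` (weight `k = 2`), even sign
(`φ(g ι_𝔸(k_π)) = φ(g)`) and `A_G`-invariant forms, descends to a non-zero classical cusp form
`f ∈ S₂(Γ₁(N))` with `φ_f ∈ W` (Gelbart 1975, Thm. 5.19 / Prop. 3.1; Gelbart 1997, (2.5.4) and
Prop. 2.5; Kudla, Thm. 4.1). Weight-one twin PROVED in the tree:
`IsOfWeightOne.exists_cuspForm_of_fixed` (`AutomorphicRepsGL2WeightOneCleanModel`).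
[cite: Gelbart1975, Thm. 5.19] [cite: Gelbart1997, (2.5.4) and Prop. 2.5] -/
def DescentTwo : Prop :=
  ∀ (hcpt : isCompact_glFiniteIntegralLevel 2 ℚ) (π : CuspidalAutomorphicRepData 2 ℚ hcpt),
    π.1.W' = ⊥ → π.1.HasArchParameter (fun _ => ({sOne, sTwo} : Multiset ℂ)) →
    (∀ φ ∈ π.1.W, ∀ g, φ (g * Rat.iotaA (rotK Real.pi)) = φ g) →
    (∀ φ ∈ π.1.W, ∀ z ∈ (AdelicGroupData.gl 2 ℚ).center', ∀ g, φ (z * g) = φ g) →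
    ∀ (N : ℕ) [NeZero N] (φ : (AdelicGroupData.gl 2 ℚ).Adelic → ℂ), φ ∈ π.1.W → φ ≠ 0 →
      (∀ u ∈ gammaOneFiniteLevel ℚ (Ideal.span {(N : 𝓞 ℚ)}),
        rightTranslation (AdelicGroupData.gl 2 ℚ) (GLn.ofFinite 2 ℚ u) φ = φ) →
      ∃ f : CuspForm (Gamma1 N) 2, f ≠ 0 ∧ adelicLiftFunA N 2 f ∈ π.1.W

/-- **Gen-4's P6 as a proposition** (`exists_cuspForm_two_of_fixed`, verbatim conclusion). -/
def CuspFormOfFixedTwo : Prop :=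
  ∀ (hcpt : isCompact_glFiniteIntegralLevel 2 ℚ) (π : AutomorphicRepData (AutomorphyDatum.gl 2 ℚ hcpt)),
    π.W' = ⊥ → π.HasArchParameter (fun _ => ({sOne, sTwo} : Multiset ℂ)) →
    (∀ φ ∈ π.W, ∀ g, φ (g * Rat.iotaA (rotK Real.pi)) = φ g) →
    π.W ≤ cuspFormsGL 2 ℚ hcpt →
    (∀ φ ∈ π.W, ∀ z ∈ (AdelicGroupData.gl 2 ℚ).center', ∀ g, φ (z * g) = φ g) →
    ∀ (N : ℕ) [NeZero N] (φ : (AdelicGroupData.gl 2 ℚ).Adelic → ℂ), φ ∈ π.W → φ ≠ 0 →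
      (∀ u ∈ gammaOneFiniteLevel ℚ (Ideal.span {(N : 𝓞 ℚ)}),
        rightTranslation (AdelicGroupData.gl 2 ℚ) (GLn.ofFinite 2 ℚ u) φ = φ) →
      ∃ ψ ∈ π.W, ψ ≠ 0 ∧
        (∀ u ∈ gammaOneFiniteLevel ℚ (Ideal.span {(N : 𝓞 ℚ)}),
          rightTranslation (AdelicGroupData.gl 2 ℚ) (GLn.ofFinite 2 ℚ u) ψ = ψ) ∧
        IsWeightVec Rat.iotaA 2 ψ ∧ lowerFun Rat.iotaA ψ = 0 ∧ lieDeriv Rat.iotaA (toLie 1) ψ = 0 ∧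
        ∃ f : CuspForm (Gamma1 N) 2,
          adelicLiftFun N 2 f = (show GL (Fin 2) (AdeleRing (𝓞 ℚ) ℚ) → ℂ from ψ) ∧ f ≠ 0

/-- **P6 ⇒ DescentTwo** (projection; PROVED). -/
theorem descentTwo_of_cuspFormOfFixedTwo (h : CuspFormOfFixedTwo) : DescentTwo := by
  intro hcpt π hbot hpar hpos hAG N _ φ hφ hφ0 hfix
  obtain ⟨ψ, hψW, hψ0, -, -, -, -, f, hf, hf0⟩ := h hcpt π.1 hbot hpar hpos π.2 hAG N φ hφ hφ0 hfix
  refine ⟨f, hf0, ?_⟩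
  change adelicLiftFun N 2 ⇑f ∈ π.1.W
  rw [hf]
  exact hψW


/-! ## §2b  Gen-4's archimedean layer (copied verbatim, PROVED there): parity, P3, P3-fin,
`hasArchWeight_of_isWeightVec` — needed to derive `CuspFormOfFixedTwo` from the rigidity lemma P4 -/


section Arch

variable {G : Type*} [Group G] {ι : (RealMatrixGroup.gl ℝ (Fin 2)).carrier →* G} {m : ℤ}
  {φ : G → ℂ}

/-- **Parity (even)**: if `k_π = -1` acts trivially on a non-zero vector of weight `m`, then `m` is
even (mirror of `IsWeightVec.odd`; Gelbart 1997, proof of Prop. 4.2). PROVED. -/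
theorem even_of_isWeightVec (hφ : IsWeightVec ι m φ) (hpos : ∀ g, φ (g * ι (rotK Real.pi)) = φ g)
    (h0 : φ ≠ 0) : Even m := by
  obtain ⟨g, hg⟩ : ∃ g, φ g ≠ 0 := Function.ne_iff.1 h0
  have h1 : (-1 : ℂ) ^ m * φ g = φ g := by rw [← hφ.apply_mul_rotK_pi g, hpos g]
  have h2 : (-1 : ℂ) ^ m = 1 := by
    have h3 : ((-1 : ℂ) ^ m - 1) * φ g = 0 := by linear_combination h1
    have h4 : (-1 : ℂ) ^ m - 1 = 0 := (mul_eq_zero.1 h3).resolve_right hg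
    linear_combination h4
  rcases Int.even_or_odd m with he | ho
  · exact he
  · rw [ho.neg_one_zpow] at h2; norm_num at h2

/-- **P3 (PROVED) — weight-TWO extraction at Casimir `0` from an even `K`-type.** Port of
`GL2Real.exists_isWeightVec_one_lowerFun_eq_zero` from (`Ω = -1/2`, odd) to (`Ω = 0`, even): on
weight `m`, `X̄ X = (2·0 - m² + 2m) = -m(m-2)` (`raiseFun_lowerFun_of_isWeightVec`), so from an even
weight `2j + 2 ≥ 4` (after `r(ε)` if `m < 0`) `X` descends non-trivially to weight `2`; at weight
`2`, either `X u = 0` (done) or `X u ≠ 0` has weight `0`; a weight-`0` vector `w ≠ 0` with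
`X w ≠ 0` gives `ε(X w)` of weight `2` killed by `X` (`archTranslate_epsK_raiseFun`, `X̄ X w = 0`);
if `X w = 0` the same applies to `r(ε) w` unless also `X (r(ε) w) = ε (X̄ w) = 0`, i.e. `w` is
killed by `X` and `X̄` — the case excluded by `hrigid` (for cusp forms such `w` are constants, P4).
[cite: Bump1997, Exercise 2.1.7] [cite: Gelbart1975, p. 61] -/
theorem exists_isWeightVec_two_lowerFun_eq_zero {W₁ : Submodule ℂ (G → ℂ)}
    (hsmooth : ∀ φ ∈ W₁, IsArchSmooth ι φ)
    (heps : ∀ φ ∈ W₁, archTranslate ι epsK φ ∈ W₁)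
    (hlie : ∀ (X : Matrix (Fin 2) (Fin 2) ℝ), ∀ φ ∈ W₁, lieDeriv ι (toLie X) φ ∈ W₁)
    (hcas : ∀ φ ∈ W₁, casimirFun ι φ = (0 : ℂ) • φ)
    (hrigid : ∀ φ ∈ W₁, IsWeightVec ι 0 φ → lowerFun ι φ = 0 → raiseFun ι φ = 0 → φ = 0)
    {m : ℤ} (hm : Even m) {v : G → ℂ} (hvW : v ∈ W₁) (hv0 : v ≠ 0) (hv : IsWeightVec ι m v) :
    ∃ ψ ∈ W₁, ψ ≠ 0 ∧ IsWeightVec ι 2 ψ ∧ lowerFun ι ψ = 0 := by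
  -- membership of `X φ` in `W₁`
  have hlow : ∀ φ ∈ W₁, lowerFun ι φ ∈ W₁ := fun φ hφ =>
    W₁.sub_mem (hlie _ φ hφ) (W₁.smul_mem _ (W₁.add_mem (hlie _ φ hφ) (hlie _ φ hφ)))
  -- `r(ε)` is injective
  have heps0 : ∀ φ : G → ℂ, archTranslate ι epsK φ = 0 → φ = 0 := fun φ h => by
    have h2 : archTranslate ι epsK (archTranslate ι epsK φ) = φ := by
      rw [← Module.End.mul_apply, ← map_mul, epsK_mul_epsK, map_one, Module.End.one_apply]
    rw [← h2, h, map_zero]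
  -- Case A: a weight-zero vector NOT killed by `X`: `ε (X u)` has weight `2` and is killed by `X`
  have caseA : ∀ u ∈ W₁, IsWeightVec ι 0 u → lowerFun ι u ≠ 0 →
      ∃ ψ ∈ W₁, ψ ≠ 0 ∧ IsWeightVec ι 2 ψ ∧ lowerFun ι ψ = 0 := by
    intro u huW hu hL
    have hwW := hlow u huW
    have hww : IsWeightVec ι (-2) (lowerFun ι u) := by
      have h := hu.weight_lowerFun (hsmooth u huW); norm_num at h; exact h
    have hRw : raiseFun ι (lowerFun ι u) = 0 := by
      rw [raiseFun_lowerFun_of_isWeightVec (hsmooth u huW) hu (hcas u huW)]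
      norm_num
    refine ⟨archTranslate ι epsK (lowerFun ι u), heps _ hwW, fun h => hL (heps0 _ h), ?_, ?_⟩
    · have h := hww.archTranslate_epsK; norm_num at h; exact h
    · rw [← archTranslate_epsK_raiseFun (hsmooth _ (heps _ hwW)), hRw, map_zero]
  -- the weight-zero case: `u` or `r(ε) u` is in Case A, unless `u` is killed by `X` and `X̄`
  have zero : ∀ u ∈ W₁, u ≠ 0 → IsWeightVec ι 0 u →
      ∃ ψ ∈ W₁, ψ ≠ 0 ∧ IsWeightVec ι 2 ψ ∧ lowerFun ι ψ = 0 := by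
    intro u huW hu0 hu
    by_cases hL : lowerFun ι u = 0
    · have hu'W := heps u huW
      have hu' : IsWeightVec ι 0 (archTranslate ι epsK u) := by
        have h := hu.archTranslate_epsK; norm_num at h; exact h
      by_cases hL' : lowerFun ι (archTranslate ι epsK u) = 0
      · exfalso
        have hR : raiseFun ι u = 0 := by
          apply heps0
          rw [archTranslate_epsK_raiseFun (hsmooth _ hu'W), hL']
        exact hu0 (hrigid u huW hu hL hR)
      · exact caseA _ hu'W hu' hL'
    · exact caseA u huW hu hL
  -- the positive even case `m = 2j + 2`, by induction on `j`
  have pos : ∀ (j : ℕ) (u : G → ℂ), u ∈ W₁ → u ≠ 0 → IsWeightVec ι (2 * (j : ℤ) + 2) u →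
      ∃ ψ ∈ W₁, ψ ≠ 0 ∧ IsWeightVec ι 2 ψ ∧ lowerFun ι ψ = 0 := by
    intro j
    induction j with
    | zero =>
      intro u huW hu0 hu
      simp only [Nat.cast_zero, mul_zero, zero_add] at hu
      by_cases hL : lowerFun ι u = 0
      · exact ⟨u, huW, hu0, hu, hL⟩
      · have hww : IsWeightVec ι 0 (lowerFun ι u) := by
          have h := hu.weight_lowerFun (hsmooth u huW); norm_num at h; exact h
        exact zero (lowerFun ι u) (hlow u huW) hL hww
    | succ j ih =>
      intro u huW hu0 hu
      have hwW := hlow u huW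
      have hww : IsWeightVec ι (2 * (j : ℤ) + 2) (lowerFun ι u) := by
        have h := hu.weight_lowerFun (hsmooth u huW)
        push_cast at h ⊢
        convert h using 2
        ring
      have hw0 : lowerFun ι u ≠ 0 := by
        intro h0
        have hRL := raiseFun_lowerFun_of_isWeightVec (hsmooth u huW) hu (hcas u huW)
        rw [h0, GL2Real.raiseFun_zero] at hRL
        rcases smul_eq_zero.1 hRL.symm with hc0 | hu00
        · push_cast at hc0
          have h' : (2 * (j : ℂ) + 4) * (2 * (j : ℂ) + 2) = 0 := by linear_combination -hc0
          have hne : (2 * (j : ℂ) + 4) * (2 * (j : ℂ) + 2) ≠ 0 := by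
            exact_mod_cast (show (2 * j + 4) * (2 * j + 2) ≠ 0 by positivity)
          exact hne h'
        · exact hu0 hu00
      exact ih (lowerFun ι u) hwW hw0 hww
  -- reduce to the cases
  obtain ⟨k, rfl⟩ := hm
  rcases lt_trichotomy k 0 with hk | rfl | hk
  · -- negative weight: apply `r(ε)`
    have hv' := hv.archTranslate_epsK
    obtain ⟨j, hj⟩ : ∃ j : ℕ, (j : ℤ) = -k - 1 := ⟨(-k - 1).toNat, Int.toNat_of_nonneg (by omega)⟩
    have hk' : -(k + k) = 2 * (j : ℤ) + 2 := by omega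
    rw [hk'] at hv'
    exact pos j _ (heps v hvW) (fun h => hv0 (heps0 v h)) hv'
  · simp only [add_zero] at hv
    exact zero v hvW hv0 hv
  · obtain ⟨j, hj⟩ : ∃ j : ℕ, (j : ℤ) = k - 1 := ⟨(k - 1).toNat, Int.toNat_of_nonneg (by omega)⟩
    have hk' : k + k = 2 * (j : ℤ) + 2 := by omega
    rw [hk'] at hv
    exact pos j v hvW hv0 hv

/-- **P3, assembled form (PROVED)**: a non-zero `SO(2)`-finite vector on which `k_π` acts
trivially, in a stable space with `Ω = 0` and no non-zero weight-`0` vector killed by `X`, `X̄`,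
yields a non-zero weight-`2` vector killed by `X` (`exists_isWeightVec_mem_of_finiteDimensional`,
`even_of_isWeightVec`, `exists_isWeightVec_two_lowerFun_eq_zero`). -/
theorem exists_isWeightVec_two_lowerFun_eq_zero_of_finite {W₁ : Submodule ℂ (G → ℂ)}
    (hsmooth : ∀ φ ∈ W₁, IsArchSmooth ι φ)
    (heps : ∀ φ ∈ W₁, archTranslate ι epsK φ ∈ W₁)
    (hlie : ∀ (X : Matrix (Fin 2) (Fin 2) ℝ), ∀ φ ∈ W₁, lieDeriv ι (toLie X) φ ∈ W₁)
    (hcas : ∀ φ ∈ W₁, casimirFun ι φ = (0 : ℂ) • φ)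
    (hpos : ∀ φ ∈ W₁, ∀ g, φ (g * ι (rotK Real.pi)) = φ g)
    (hrigid : ∀ φ ∈ W₁, IsWeightVec ι 0 φ → lowerFun ι φ = 0 → raiseFun ι φ = 0 → φ = 0)
    {φ : G → ℂ} (hφ0 : φ ≠ 0)
    (hfin : ∃ V : Submodule ℂ (G → ℂ), FiniteDimensional ℂ V ∧ φ ∈ V ∧ V ≤ W₁ ∧
      ∀ θ : ℝ, ∀ ψ ∈ V, archTranslate ι (rotK θ) ψ ∈ V) :
    ∃ ψ ∈ W₁, ψ ≠ 0 ∧ IsWeightVec ι 2 ψ ∧ lowerFun ι ψ = 0 := by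
  obtain ⟨V, hVfd, hφV, hVW, hVrot⟩ := hfin
  haveI := hVfd
  have hV : V ≠ ⊥ := fun h => hφ0 (by rw [h] at hφV; exact (Submodule.mem_bot ℂ).1 hφV)
  obtain ⟨m, v, hvV, hv0, hv⟩ :=
    exists_isWeightVec_mem_of_finiteDimensional hV hVrot fun ψ hψ => hsmooth ψ (hVW hψ)
  have heven : Even m := even_of_isWeightVec hv (hpos v (hVW hvV)) hv0
  exact exists_isWeightVec_two_lowerFun_eq_zero hsmooth heps hlie hcas hrigid heven (hVW hvV) hv0 hv

/-- **`HasArchWeight m` for every `m` (PROVED)** — verbatim generalisation of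
`GL2Real.hasArchWeight_one_of_isWeightVec` (`1 ↦ m`). -/
theorem hasArchWeight_of_isWeightVec {j : GL (Fin 2) ℝ →* G} {ψ : G → ℂ}
    (hw : IsWeightVec (inclOf j) m ψ) (hs : IsArchSmooth (inclOf j) ψ)
    (hZ : lieDeriv (inclOf j) (toLie 1) ψ = 0) (a : G) :
    HasArchWeight m fun y => ψ (a * j y) := by
  refine hasArchWeight_of_rotGL_of_realScalarGL (fun g θ _ => ?_) (fun g r hr _ => ?_)
  · have h := hw (-θ) (a * j g)
    have hk : inclOf j (rotK (-θ)) = j (rotGL θ) := by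
      change j (rotGL (-(-θ))) = _; rw [neg_neg]
    rw [hk, mul_assoc, ← map_mul] at h
    change ψ (a * j (g * rotGL θ)) = ψ (a * j g) * _
    rw [h, ← Complex.exp_int_mul]
    push_cast
    ring_nf
  · rw [map_mul, ← mul_assoc]
    exact apply_mul_realScalarGL_of_lieDeriv_one hs hZ _ hr

end Arch

/-! ## §2c  NEW in gen 5: the rigidity lemma P4 is PROVED — a weight-`0` vector killed by
`X`, `X̄`, `Z` is killed by ALL of `𝔤𝔩₂(ℝ)`, and a cusp form killed by the square-zero directions
at the real place vanishes (`eq_zero_of_mem_cuspFormsGL_of_forall_lieDeriv_realPlace`, tree). -/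

section Killed

variable {G : Type*} [Group G] {ι : (RealMatrixGroup.gl ℝ (Fin 2)).carrier →* G}

/-- `X = x₁₁ E₁₁ + x₁₂ E₁₂ + x₂₁ E₂₁ + x₂₂ E₂₂`. [folklore] -/
theorem matrix_eq_smul_e_add (X : Matrix (Fin 2) (Fin 2) ℝ) :
    X = X 0 0 • e₁₁ + X 0 1 • e₁₂ + X 1 0 • e₂₁ + X 1 1 • e₂₂ := by
  ext i j; fin_cases i <;> fin_cases j <;> simp [e₁₁, e₁₂, e₂₁, e₂₂]

/-- `1 = E₁₁ + E₂₂`. [folklore] -/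
theorem matrix_one_eq_e₁₁_add_e₂₂ : (1 : Matrix (Fin 2) (Fin 2) ℝ) = e₁₁ + e₂₂ := by
  ext i j; fin_cases i <;> fin_cases j <;> simp [e₁₁, e₂₂]

/-- **A smooth weight-`0` vector killed by `Z`, `X`, `X̄` is killed by every `Y ∈ 𝔤𝔩₂(ℝ)`**:
`X + X̄ = 2h`, `X̄ - X = 2i(E₁₂ + E₂₁)`, `W = E₁₂ - E₂₁` acts by `i·0` on weight `0`
(`IsWeightVec.lieDeriv_rotGen`), `Z = E₁₁ + E₂₂`, `h = E₁₁ - E₂₂`; so the four coordinate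
derivatives vanish, and `Y ↦ Y φ` is `ℝ`-linear (`IsArchSmooth.lieDeriv_add_left/smul_left`).
[cite: Bump1997, §2.2 ((2.23), (2.33))] -/
theorem lieDeriv_toLie_eq_zero_of_killed {ψ : G → ℂ} (hs : IsArchSmooth ι ψ) (hw0 : IsWeightVec ι 0 ψ)
    (hZ0 : lieDeriv ι (toLie 1) ψ = 0) (hL0 : lowerFun ι ψ = 0) (hR0 : raiseFun ι ψ = 0)
    (X : Matrix (Fin 2) (Fin 2) ℝ) : lieDeriv ι (toLie X) ψ = 0 := by
  have hA : lieDeriv ι (toLie hMat) ψ = 0 := by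
    funext g
    have a := congrFun hL0 g
    have b := congrFun hR0 g
    simp only [lowerFun, raiseFun, Pi.add_apply, Pi.sub_apply, Pi.smul_apply, smul_eq_mul, Pi.zero_apply] at a b
    rw [Pi.zero_apply]
    linear_combination (a + b) / 2
  have hB : lieDeriv ι (toLie e₁₂) ψ + lieDeriv ι (toLie e₂₁) ψ = 0 := by
    funext g
    have a := congrFun hL0 g
    have b := congrFun hR0 g
    simp only [lowerFun, raiseFun, Pi.add_apply, Pi.sub_apply, Pi.smul_apply, smul_eq_mul, Pi.zero_apply] at a b
    rw [Pi.add_apply, Pi.zero_apply]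
    have hI : Complex.I * Complex.I = -1 := Complex.I_mul_I
    linear_combination (Complex.I * (a - b)) / 2 + ((lieDeriv ι (toLie e₁₂) ψ g + lieDeriv ι (toLie e₂₁) ψ g)) * hI
  have hW : lieDeriv ι (toLie e₁₂) ψ - lieDeriv ι (toLie e₂₁) ψ = 0 := by
    rw [← lieDeriv_rotGen_eq_sub hs, hw0.lieDeriv_rotGen]
    simp
  have h12 : lieDeriv ι (toLie e₁₂) ψ = 0 := by
    funext g
    have a := congrFun hB g
    have b := congrFun hW g
    simp only [Pi.add_apply, Pi.sub_apply, Pi.zero_apply] at a b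
    rw [Pi.zero_apply]
    linear_combination (a + b) / 2
  have h21 : lieDeriv ι (toLie e₂₁) ψ = 0 := by
    funext g
    have a := congrFun hB g
    have b := congrFun hW g
    simp only [Pi.add_apply, Pi.sub_apply, Pi.zero_apply] at a b
    rw [Pi.zero_apply]
    linear_combination (a - b) / 2
  have hh : lieDeriv ι (toLie hMat) ψ = lieDeriv ι (toLie e₁₁) ψ - lieDeriv ι (toLie e₂₂) ψ := by
    have e : toLie hMat = (1 : ℝ) • toLie e₁₁ - (1 : ℝ) • toLie e₂₂ := by rw [one_smul, one_smul]; rfl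
    rw [e, lieDeriv_smul_sub_smul_of_isArchSmooth hs, one_smul, one_smul]
  have h1 : lieDeriv ι (toLie 1) ψ = lieDeriv ι (toLie e₁₁) ψ + lieDeriv ι (toLie e₂₂) ψ := by
    rw [matrix_one_eq_e₁₁_add_e₂₂, toLie_add, hs.lieDeriv_add_left ι]
  have h11 : lieDeriv ι (toLie e₁₁) ψ = 0 := by
    funext g
    have a := congrFun hA g
    have b := congrFun hZ0 g
    rw [hh] at a
    rw [h1] at b
    simp only [Pi.add_apply, Pi.sub_apply, Pi.zero_apply] at a b
    rw [Pi.zero_apply]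
    linear_combination (a + b) / 2
  have h22 : lieDeriv ι (toLie e₂₂) ψ = 0 := by
    funext g
    have a := congrFun hA g
    have b := congrFun hZ0 g
    rw [hh] at a
    rw [h1] at b
    simp only [Pi.add_apply, Pi.sub_apply, Pi.zero_apply] at a b
    rw [Pi.zero_apply]
    linear_combination (b - a) / 2
  rw [matrix_eq_smul_e_add X]
  simp only [toLie_add, toLie_smul, hs.lieDeriv_add_left ι, hs.lieDeriv_smul_left ι, h11, h12, h21, h22,
    smul_zero, add_zero]

end Killed


/-- **P4 as a proposition = `RigidityTwo` (the residual after this file).** A `K₁(N)`-fixed form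
`ψ ∈ W` (`W` cuspidal) of `SO(2)`-weight `0` killed by `X`, `X̄` and `Z` vanishes (gen-4
`eq_zero_of_isWeightVec_zero`, sorried there; its two inputs are P4a — weight-`0` functions on
`GL₂(ℝ)⁺` killed by `E₁₁`, `E₁₂` are constant — and P4b — constants are not cuspidal).
[cite: Gelbart1975, p. 61] [cite: Bump1997, Exercise 2.1.8] -/
def RigidityTwo : Prop :=
  ∀ (hcpt : isCompact_glFiniteIntegralLevel 2 ℚ) (π : AutomorphicRepData (AutomorphyDatum.gl 2 ℚ hcpt)),
    π.W ≤ cuspFormsGL 2 ℚ hcpt →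
    ∀ (N : ℕ) [NeZero N] (ψ : (AdelicGroupData.gl 2 ℚ).Adelic → ℂ), ψ ∈ π.W →
      (∀ u ∈ gammaOneFiniteLevel ℚ (Ideal.span {(N : 𝓞 ℚ)}),
        rightTranslation (AdelicGroupData.gl 2 ℚ) (GLn.ofFinite 2 ℚ u) ψ = ψ) →
      IsWeightVec Rat.iotaA 0 ψ → lieDeriv Rat.iotaA (toLie 1) ψ = 0 →
      lowerFun Rat.iotaA ψ = 0 → raiseFun Rat.iotaA ψ = 0 → ψ = 0

/-! ## §3  The adelic plumbing around the residual (copied from gen 4, all PROVED there) -/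

section Plumbing

variable {hcpt : isCompact_glFiniteIntegralLevel 2 ℚ}

/-- `1 ⊗ 1 = 1` under `X ↦ X ⊗ 1` (`Rat.lieOfReal`; copy of `Rat.lieOfReal_one`). [folklore] -/
theorem Rat.lieOfReal_one_g5 : Rat.lieOfReal hcpt 1 = (⟨1, trivial⟩ : (AutomorphyDatum.gl 2 ℚ hcpt).arch.lie) :=
  Subtype.ext (Matrix.map_one _ (map_zero _) (map_one _))

/-- **P0 (PROVED, gen 4) — the clean model at parameter `{s₁, s₂}` with `s₁ + s₂ = 0`**
(`exists_isShiftRealisation_of_sSup_irreducible`; exponent `μ = s₁ + s₂ = 0`, hence `A_G`-invariant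
forms; Satake parameters transfer). -/
theorem exists_clean_of_hasArchParameter {π : CuspidalAutomorphicRepData 2 ℚ hcpt} {s₁ s₂ : ℂ}
    (hpar : π.1.HasArchParameter fun _ => ({s₁, s₂} : Multiset ℂ)) (hsum : s₁ + s₂ = 0) :
    ∃ π₀ : CuspidalAutomorphicRepData 2 ℚ hcpt, π₀.1.W' = ⊥ ∧
      π₀.1.HasArchParameter (fun _ => ({s₁, s₂} : Multiset ℂ)) ∧ π₀.1.W ≤ π.1.W ∧
      (∀ φ ∈ π₀.1.W, ∀ z ∈ (AdelicGroupData.gl 2 ℚ).center', ∀ g, φ (z * g) = φ g) ∧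
      ∀ (v : HeightOneSpectrum (𝓞 ℚ)) (β : Multiset ℂ),
        π₀.1.HasSatakeParamAt v β → π.1.HasSatakeParamAt v β := by
  obtain ⟨π₀, μ, j, M, h⟩ :=
    π.exists_isShiftRealisation_of_sSup_irreducible AutomorphicRepsGL.stable_cuspidal_eq_sSup_irreducible_holds
  have h₀ : π₀.1.HasArchParameter (fun _ => ({s₁, s₂} : Multiset ℂ)) := h.hasArchParameter hpar
  have hμ : μ = 0 := by
    obtain ⟨c, hcW, hc0⟩ := Submodule.exists_mem_ne_zero_of_ne_bot h.W_ne_bot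
    have h1 := π₀.1.lieDeriv_one_sub_smul_mem h₀ hcW
    rw [hsum, zero_smul, sub_zero, ← Rat.lieDeriv_ofArch_lieOfReal_eq (hcpt := hcpt), Rat.lieOfReal_one_g5,
      h.lieDeriv_one_eq_smul hcW, h.bot, Submodule.mem_bot] at h1
    rcases smul_eq_zero.1 h1 with h2 | h2
    · exact h2
    · exact absurd h2 hc0
  exact ⟨π₀, h.bot, h₀, h.le, fun φ hφ => h.apply_center'_mul hμ hφ, fun v β hβ => h.hasSatakeParamAt hβ⟩

variable {π : AutomorphicRepData (AutomorphyDatum.gl 2 ℚ hcpt)}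

/-- **P0′ (PROVED, gen 4) — weight zero for `GL₂/ℚ` is the Harish-Chandra parameter `{1/2, -1/2}`**
(`map_a_weightZeroInfinityType_two`). -/
theorem HasWeightZero.hasArchParameter_weightTwo (h : π.HasWeightZero) :
    π.HasArchParameter fun _ => ({sOne, sTwo} : Multiset ℂ) := by
  have h2 : π.HasArchParameter fun σ => (weightZeroInfinityType 2 ℚ σ).map ArchWeight.a := h.2
  have e : (fun σ : ℚ →+* ℂ => (weightZeroInfinityType 2 ℚ σ).map ArchWeight.a) =
      fun _ => ({sOne, sTwo} : Multiset ℂ) := by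
    funext σ
    rw [map_a_weightZeroInfinityType_two]
    rfl
  rwa [e] at h2

/-- `(√n)² z = n`, `n ≠ 0` ⇒ `z = 1`. PROVED. -/
theorem eq_one_of_sqrt_sq_mul_eq {n : ℕ} (hn : n ≠ 0) {z : ℂ}
    (h : ((Real.sqrt n : ℝ) : ℂ) ^ 2 * z = (n : ℂ)) : z = 1 := by
  have hq : ((Real.sqrt n : ℝ) : ℂ) ^ 2 = (n : ℂ) := by
    rw [← Complex.ofReal_pow, Real.sq_sqrt (Nat.cast_nonneg _), Complex.ofReal_natCast]
  rw [hq] at h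
  have hn' : (n : ℂ) ≠ 0 := by exact_mod_cast hn
  exact (mul_right_inj' hn').1 (h.trans (mul_one _).symm)

/-- **P1, pointwise (PROVED) — the Satake feed transferred to the clean model at EVERY good place.**
If `π` has Hecke polynomial `X² - a_w X + q_w` at `w`, the Satake parameters of `π₀` are Satake
parameters of `π`, and `α` is a Satake parameter of `π₀` at `w`, then `∏ α = 1` and
`(√q_w)^{2-1} Σ α = a_w` (`exists_hasSatakeParamAt_of_hasHeckePolynomialAt_frobPoly`,
`hasSatakeParamAt_unique_holds`). -/
theorem satakeFeed_of_hasHeckePolynomialAt {π π₀ : AutomorphicRepData (AutomorphyDatum.gl 2 ℚ hcpt)}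
    (hsat : ∀ (v : HeightOneSpectrum (𝓞 ℚ)) (β : Multiset ℂ), π₀.HasSatakeParamAt v β → π.HasSatakeParamAt v β)
    {w : HeightOneSpectrum (𝓞 ℚ)} {a : ℤ}
    (hH : π.HasHeckePolynomialAt w ((frobPoly a w.residueCard).map (Int.castRingHom ℂ)))
    {α : Multiset ℂ} (hα : π₀.HasSatakeParamAt w α) :
    α.prod = 1 ∧ (((Real.sqrt (natGenerator w) : ℝ) : ℂ)) ^ ((2 : ℤ) - 1) * α.sum = (a : ℂ) := by
  obtain ⟨β, hβ, hsum, hprod⟩ := exists_hasSatakeParamAt_of_hasHeckePolynomialAt_frobPoly hH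
  have hαβ : α = β := π.hasSatakeParamAt_unique_holds (hsat w α hα) hβ
  subst hαβ
  rw [Rat.residueCard_eq_natGenerator] at hsum hprod
  refine ⟨eq_one_of_sqrt_sq_mul_eq (prime_natGenerator w).ne_zero hprod, ?_⟩
  rw [show ((2 : ℤ) - 1) = 1 by norm_num, zpow_one]
  exact hsum

/-- `ofArch (-1) = (-1)_∞ · 1₂` in `GL₂(𝔸_ℚ)` — copy of `ofArch_neg_one_eq_scalar_infIdele`
(`StrongArtinCentralCharacter`). [folklore] -/
theorem ofArch_neg_one_eq_scalar_infIdele' :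
    (AutomorphyDatum.gl 2 ℚ hcpt).ofArch ⟨-1, trivial⟩ =
      (show (AdelicGroupData.gl 2 ℚ).Adelic from
        Matrix.GeneralLinearGroup.scalar (Fin 2) (Rat.infIdele (-1) : ideleGroup ℚ)) := by
  open NumberField.mixedEmbedding in
  refine Matrix.GeneralLinearGroup.ext fun i j => ?_
  rw [AutomorphyDatum.gl_ofArch_apply, GLn.coe_ofInfinite_apply]
  change ((InfiniteAdeleRing.ringEquiv_mixedSpace ℚ).symm (((-1 : GL (Fin 2) (mixedSpace ℚ)) :
      Matrix (Fin 2) (Fin 2) (mixedSpace ℚ)) i j), (1 : Matrix (Fin 2) (Fin 2) (FiniteAdeleRing (𝓞 ℚ) ℚ)) i j) =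
    ((Matrix.GeneralLinearGroup.scalar (Fin 2) (Rat.infIdele (-1) : ideleGroup ℚ) :
      GL (Fin 2) (AdeleRing (𝓞 ℚ) ℚ)) : Matrix (Fin 2) (Fin 2) (AdeleRing (𝓞 ℚ) ℚ)) i j
  rw [Matrix.GeneralLinearGroup.coe_scalar, Matrix.scalar_apply, Matrix.diagonal_apply, Units.val_neg, Units.val_one,
    Matrix.neg_apply, Matrix.one_apply, Matrix.one_apply]
  by_cases hij : i = j
  · rw [if_pos hij, if_pos hij, if_pos hij, map_neg, map_one]
    refine Prod.ext ?_ ?_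
    · change (-1 : InfiniteAdeleRing ℚ) = ((Rat.infIdele (-1) : ideleGroup ℚ) : AdeleRing (𝓞 ℚ) ℚ).1
      funext w
      rw [Rat.infIdele_fst_apply, Units.val_neg, Units.val_one, map_neg, map_one]
      rfl
    · rfl
  · rw [if_neg hij, if_neg hij, if_neg hij, neg_zero, map_zero]
    rfl

/-- **P2 (PROVED, gen 4) — EVEN SIGN from the central character**: if `π = W/⊥` has at cofinitely
many places a Satake parameter with `∏ α = 1`, the archimedean `-1` acts trivially on `W`
(`exists_centralCharacter`, `HeckeCharacter.eq_one_of_eventually_valueAtUniformizer_eq_one`).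
[cite: Gelbart1997, §7.1 (a)] -/
theorem rightTranslation_ofArch_neg_one_eq_self (hbot : π.W' = ⊥)
    (h1 : ∀ᶠ v : HeightOneSpectrum (𝓞 ℚ) in cofinite, ∃ α : Multiset ℂ, π.HasSatakeParamAt v α ∧ α.prod = 1)
    {φ : (AdelicGroupData.gl 2 ℚ).Adelic → ℂ} (hφ : φ ∈ π.W) :
    rightTranslation (AdelicGroupData.gl 2 ℚ) ((AutomorphyDatum.gl 2 ℚ hcpt).ofArch ⟨-1, trivial⟩) φ = φ := by
  obtain ⟨ω, hω, hωv⟩ := π.exists_centralCharacter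
  have hω1 : ω = 1 := by
    refine HeckeCharacter.eq_one_of_eventually_valueAtUniformizer_eq_one (h1.mono ?_)
    rintro v ⟨α, hα, hprod⟩
    rw [(hωv hα).2, hprod]
  have h := hω (Rat.infIdele (-1)) φ hφ
  rw [hbot, Submodule.mem_bot, sub_eq_zero, hω1] at h
  simp only [HeckeCharacter.one_apply, Units.val_one, one_smul] at h
  rw [ofArch_neg_one_eq_scalar_infIdele']
  exact h

/-- **P2′ (PROVED, gen 4)** — the same read along `ι_𝔸`: `φ(g · ι_𝔸(k_π)) = φ(g)`. -/
theorem apply_mul_iotaA_rotK_pi_eq_self (hbot : π.W' = ⊥)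
    (h1 : ∀ᶠ v : HeightOneSpectrum (𝓞 ℚ) in cofinite, ∃ α : Multiset ℂ, π.HasSatakeParamAt v α ∧ α.prod = 1)
    {φ : (AdelicGroupData.gl 2 ℚ).Adelic → ℂ} (hφ : φ ∈ π.W) (g : (AdelicGroupData.gl 2 ℚ).Adelic) :
    φ (g * Rat.iotaA (rotK Real.pi)) = φ g := by
  have h := congrFun (rightTranslation_ofArch_neg_one_eq_self hbot h1 hφ) g
  rw [rightTranslation_apply, ← Rat.iotaA_rotK_pi (hcpt := hcpt)] at h
  exact h

/-- **P9 (PROVED, gen 4) — the exceptional modulus `R = |Δ(E)|` and `a_w(E) = a_p(E ⊗ ℚ)` at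
`p ∤ R`.** -/
theorem exists_R_lFunction_eq_frobTraceAt {E : WeierstrassCurve (𝓞 ℚ)} (hΔ : E.Δ ≠ 0) :
    ∃ R : ℕ, R ≠ 0 ∧ ∀ v : HeightOneSpectrum (𝓞 ℚ), ¬ natGenerator v ∣ R →
      E.Δ ∉ v.asIdeal ∧
      ((E.baseChange ℚ).LFunction (natGenerator v) : ℂ) = (frobTraceAt E v : ℂ) := by
  have hzΔ : (((Rat.ringOfIntegersEquiv E.Δ : ℤ)) : 𝓞 ℚ) = E.Δ := by
    rw [← eq_intCast Rat.ringOfIntegersEquiv.symm, RingEquiv.symm_apply_apply]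
  have hz0 : (Rat.ringOfIntegersEquiv E.Δ : ℤ) ≠ 0 := fun h => hΔ (by rw [← hzΔ, h, Int.cast_zero])
  refine ⟨(Rat.ringOfIntegersEquiv E.Δ : ℤ).natAbs, Int.natAbs_ne_zero.2 hz0, fun v hv => ?_⟩
  have hΔv : E.Δ ∉ v.asIdeal := fun hmem => hv (by
    rw [← hzΔ, Rat.intCast_mem_asIdeal_iff] at hmem
    exact Int.ofNat_dvd_left.1 hmem)
  refine ⟨hΔv, ?_⟩
  have h1 := WeierstrassCurve.lFunction_primesEquiv_eq_frobeniusTraceAt (E.baseChange ℚ)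
    (hasGoodReductionAt_baseChange_of_Δ_not_mem hΔv)
  have h2 : ((primesEquiv v : Nat.Primes) : ℕ) = natGenerator v := rfl
  rw [h2, frobeniusTraceAt_baseChange_eq_frobTraceAt hΔv] at h1
  rw [h1]


/-- **P3-adelic (PROVED modulo nothing: uses P3) — a weight-TWO vector killed by `X` and `Z` in
every stable `W₁ ≤ W`** (port of `exists_isWeightVec_one_of_isOfWeightOne`): parameter
`{1/2,-1/2}` gives `Z = 0` and `C = s₁² + s₂² - ½ = 0` exactly on `W` (`lieDeriv_one_sub_smul_mem`,
`sum_lieDeriv_single_sub_smul_mem`, `W' = ⊥`), so `Ω = C - ½ Z² = 0`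
(`GL2Real.casimirFun_add_half_zz`); even sign `hpos`; rigidity `hrigid`; `K_∞`-finiteness
`exists_finiteDimensional_rotation_span`. -/
theorem exists_isWeightVec_two_of_hasArchParameter (hbot : π.W' = ⊥)
    (hpar : π.HasArchParameter fun _ => ({sOne, sTwo} : Multiset ℂ))
    (hpos : ∀ φ ∈ π.W, ∀ g, φ (g * Rat.iotaA (rotK Real.pi)) = φ g)
    {W₁ : Submodule ℂ ((AdelicGroupData.gl 2 ℚ).Adelic → ℂ)} (hW₁ : W₁ ≤ π.W)
    (heps : ∀ φ ∈ W₁, archTranslate Rat.iotaA epsK φ ∈ W₁)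
    (hrot : ∀ θ : ℝ, ∀ φ ∈ W₁, archTranslate Rat.iotaA (rotK θ) φ ∈ W₁)
    (hlie : ∀ (X : Matrix (Fin 2) (Fin 2) ℝ), ∀ φ ∈ W₁, lieDeriv Rat.iotaA (toLie X) φ ∈ W₁)
    (hrigid : ∀ φ ∈ W₁, IsWeightVec Rat.iotaA 0 φ → lieDeriv Rat.iotaA (toLie 1) φ = 0 →
      lowerFun Rat.iotaA φ = 0 → raiseFun Rat.iotaA φ = 0 → φ = 0)
    {φ : (AdelicGroupData.gl 2 ℚ).Adelic → ℂ} (hφ : φ ∈ W₁) (hφ0 : φ ≠ 0) :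
    ∃ ψ ∈ W₁, ψ ≠ 0 ∧ IsWeightVec Rat.iotaA 2 ψ ∧ lowerFun Rat.iotaA ψ = 0 ∧
      lieDeriv Rat.iotaA (toLie 1) ψ = 0 := by
  have hsmooth : ∀ ψ ∈ W₁, IsArchSmooth Rat.iotaA ψ := fun ψ hψ =>
    (π.isArchSmooth_of_mem_W (hW₁ hψ)).iotaA
  have hZ : ∀ ψ ∈ π.W, lieDeriv Rat.iotaA (toLie 1) ψ = 0 := fun ψ hψ => by
    have h := π.lieDeriv_one_sub_smul_mem hpar hψ
    rw [hbot, Submodule.mem_bot, sOne_add_sTwo, zero_smul, sub_zero] at h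
    exact h
  have hcas : ∀ ψ ∈ W₁, casimirFun Rat.iotaA ψ = (0 : ℂ) • ψ := fun ψ hψ => by
    have h := π.sum_lieDeriv_single_sub_smul_mem hpar (hW₁ hψ)
    rw [hbot, Submodule.mem_bot, sub_eq_zero] at h
    have hid := GL2Real.casimirFun_add_half_zz (hsmooth ψ hψ)
    rw [hZ ψ (hW₁ hψ), lieDeriv_zero_right, smul_zero, add_zero] at hid
    rw [hid, h, sOne_sq_add_sTwo_sq]
  obtain ⟨ψ, hψW, hψ0, hw, hL⟩ := exists_isWeightVec_two_lowerFun_eq_zero_of_finite hsmooth heps hlie hcas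
    (fun ψ hψ g => hpos ψ (hW₁ hψ) g)
    (fun ψ hψ hw0 hL0 hR0 => hrigid ψ hψ hw0 (hZ ψ (hW₁ hψ)) hL0 hR0) hφ0
    (π.exists_finiteDimensional_rotation_span hW₁ hrot hφ)
  exact ⟨ψ, hψW, hψ0, hw, hL, hZ ψ (hW₁ hψW)⟩


/-- **P6 ⇐ P4 (PROVED here): gen-4's descent `exists_cuspForm_two_of_fixed` from the rigidity lemma
alone.** Port of the tree's PROVED `IsOfWeightOne.exists_cuspForm_of_fixed` (`1 ↦ 2`): the stable
subspace `W₁ = W ∩ Fix K₁(N)` (`Rat.ofRealGL_mul_ofFinite_comm`), P3-adelic with `hrigid := P4|W₁`,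
Gelbart's (2.5.4) via `hasArchWeight_of_isWeightVec` (`m = 2`), `isArchSmooth_incl_of_inclOf`,
`lowering_eq_zero_of_lowerFun_eq_zero`, `cuspidal_bounded_holds`, and
`adelicDescentCuspForm N 2 two_pos` / `adelicLiftFun_adelicDescentCuspForm`.
[cite: Gelbart1997, (2.5.4) and Prop. 2.5] [cite: Gelbart1975, Thm. 5.19] -/
theorem cuspFormOfFixedTwo_of_rigidityTwo (hrig : RigidityTwo) : CuspFormOfFixedTwo := by
  intro hcpt π hbot hpar hpos hcusp hAG N _ φ hφ hφ0 hfix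
  -- the archimedean and finite-adelic factors commute
  have hcomm : ∀ (x : (RealMatrixGroup.gl ℝ (Fin 2)).carrier) (u : GL (Fin 2) (FiniteAdeleRing (𝓞 ℚ) ℚ)),
      Rat.iotaA x * (show (AdelicGroupData.gl 2 ℚ).Adelic from GLn.ofFinite 2 ℚ u) =
        (show (AdelicGroupData.gl 2 ℚ).Adelic from GLn.ofFinite 2 ℚ u) * Rat.iotaA x := fun x u =>
    Rat.ofRealGL_mul_ofFinite_comm 2 (x : GL (Fin 2) ℝ) u
  -- `W₁ = W ∩ Fix(K₁(N))`
  let W₁ : Submodule ℂ ((AdelicGroupData.gl 2 ℚ).Adelic → ℂ) :=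
    { carrier := {ψ | ψ ∈ π.W ∧ ∀ u ∈ gammaOneFiniteLevel ℚ (Ideal.span {(N : 𝓞 ℚ)}),
        rightTranslation (AdelicGroupData.gl 2 ℚ) (GLn.ofFinite 2 ℚ u) ψ = ψ}
      add_mem' := fun {a b} ha hb => ⟨add_mem ha.1 hb.1, fun u hu => by rw [map_add, ha.2 u hu, hb.2 u hu]⟩
      zero_mem' := ⟨zero_mem _, fun u _ => map_zero _⟩
      smul_mem' := fun c x hx => ⟨Submodule.smul_mem _ c hx.1, fun u hu => by rw [map_smul, hx.2 u hu]⟩ }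
  have hW₁mem : ∀ ψ, ψ ∈ W₁ ↔ ψ ∈ π.W ∧ ∀ u ∈ gammaOneFiniteLevel ℚ (Ideal.span {(N : 𝓞 ℚ)}),
      rightTranslation (AdelicGroupData.gl 2 ℚ) (GLn.ofFinite 2 ℚ u) ψ = ψ := fun ψ => Iff.rfl
  have hW₁ : W₁ ≤ π.W := fun ψ hψ => ((hW₁mem ψ).1 hψ).1
  -- stability of `W₁` under `r(ι_𝔸 k)` for `k ∈ GL₂(ℝ)` with `r(ι_𝔸 k) W ⊆ W`
  have harch : ∀ (x : (RealMatrixGroup.gl ℝ (Fin 2)).carrier) (ψ : (AdelicGroupData.gl 2 ℚ).Adelic → ℂ),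
      ψ ∈ W₁ → archTranslate Rat.iotaA x ψ ∈ π.W → archTranslate Rat.iotaA x ψ ∈ W₁ := by
    intro x ψ hψ hmem
    refine (hW₁mem _).2 ⟨hmem, fun u hu => ?_⟩
    funext g
    rw [rightTranslation_apply, archTranslate_apply, archTranslate_apply, mul_assoc, ← hcomm x u, ← mul_assoc]
    exact congrFun (((hW₁mem ψ).1 hψ).2 u hu) (g * Rat.iotaA x)
  have heps : ∀ ψ ∈ W₁, archTranslate Rat.iotaA epsK ψ ∈ W₁ := fun ψ hψ =>
    harch epsK ψ hψ (π.archTranslate_iotaA_epsK_mem (hW₁ hψ))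
  have hrot : ∀ θ : ℝ, ∀ ψ ∈ W₁, archTranslate Rat.iotaA (rotK θ) ψ ∈ W₁ := fun θ ψ hψ =>
    harch (rotK θ) ψ hψ (π.archTranslate_iotaA_rotK_mem (hW₁ hψ) θ)
  have hlie : ∀ (X : Matrix (Fin 2) (Fin 2) ℝ), ∀ ψ ∈ W₁, lieDeriv Rat.iotaA (toLie X) ψ ∈ W₁ := by
    intro X ψ hψ
    refine (hW₁mem _).2 ⟨π.lieDeriv_iotaA_mem (hW₁ hψ) X, fun u hu => ?_⟩
    have hfixψ := ((hW₁mem ψ).1 hψ).2 u hu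
    have e : rightTranslation (AdelicGroupData.gl 2 ℚ) (GLn.ofFinite 2 ℚ u) (lieDeriv Rat.iotaA (toLie X) ψ) =
        fun g => lieDeriv Rat.iotaA (toLie X) ψ (g * (show (AdelicGroupData.gl 2 ℚ).Adelic from GLn.ofFinite 2 ℚ u)) := rfl
    have e' : (fun g => ψ (g * (show (AdelicGroupData.gl 2 ℚ).Adelic from GLn.ofFinite 2 ℚ u))) = ψ := hfixψ
    rw [e, ← lieDeriv_comp_mul_right Rat.iotaA (toLie X) ψ (fun x => hcomm x u), e']
  have hφW₁ : φ ∈ W₁ := (hW₁mem φ).2 ⟨hφ, hfix⟩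
  -- P4 restricted to `W₁`
  have hrigid : ∀ ψ ∈ W₁, IsWeightVec Rat.iotaA 0 ψ → lieDeriv Rat.iotaA (toLie 1) ψ = 0 →
      lowerFun Rat.iotaA ψ = 0 → raiseFun Rat.iotaA ψ = 0 → ψ = 0 := fun ψ hψ hw0 hZ0 hL0 hR0 =>
    hrig hcpt π hcusp N ψ (hW₁ hψ) ((hW₁mem ψ).1 hψ).2 hw0 hZ0 hL0 hR0
  -- the weight-two vector inside `W₁` (P3-adelic, PROVED in gen 4)
  obtain ⟨ψ, hψW₁, hψ0, hw, hL, hZ⟩ :=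
    exists_isWeightVec_two_of_hasArchParameter hbot hpar hpos hW₁ heps hrot hlie hrigid hφW₁ hφ0
  have hψW : ψ ∈ π.W := hW₁ hψW₁
  have hψfix := ((hW₁mem ψ).1 hψW₁).2
  -- Gelbart's conditions (2.5.4)
  have hs : IsArchSmooth Rat.iotaA ψ := (π.isArchSmooth_of_mem_W hψW).iotaA
  have hw1 := hasArchWeight_of_isWeightVec hw hs hZ 1
  have hs1 := isArchSmooth_incl_of_inclOf hs 1
  have hl1 := fun x => lowering_eq_zero_of_lowerFun_eq_zero hL 1 x
  have e1 : (fun g : GL (Fin 2) ℝ => ψ (1 * Rat.ofRealGLA g)) = fun g : GL (Fin 2) ℝ => ψ (Rat.ofRealGLA g) :=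
    funext fun g => by rw [one_mul]
  rw [e1] at hw1 hs1
  simp only [e1] at hl1
  have hleft : ∀ (γ : GL (Fin 2) ℚ) (g : GL (Fin 2) (AdeleRing (𝓞 ℚ) ℚ)),
      ψ ((show (AdelicGroupData.gl 2 ℚ).Adelic from GLn.ofGlobal 2 ℚ γ * g)) = ψ g := fun γ g =>
    (π.isAutomorphicForm_of_mem_W hψW).leftInvariant (GLn.ofGlobal 2 ℚ γ) ⟨γ, rfl⟩ g
  have hright : ∀ u ∈ gammaOneFiniteLevel ℚ (Ideal.span {(N : 𝓞 ℚ)}), ∀ g : GL (Fin 2) (AdeleRing (𝓞 ℚ) ℚ),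
      ψ ((show (AdelicGroupData.gl 2 ℚ).Adelic from g * GLn.ofFinite 2 ℚ u)) = ψ g := fun u hu g =>
    congrFun (hψfix u hu) g
  obtain ⟨C, hC⟩ := AutomorphicRepsGL.cuspidal_bounded_holds ψ (hcusp hψW) (hAG ψ hψW)
  have hbdd : ∃ C : ℝ, ∀ x : GL (Fin 2) ℝ, 0 < x.det.val → ‖ψ (Rat.ofRealGLA x)‖ ≤ C := ⟨C, fun x _ => hC _⟩
  let f : CuspForm (Gamma1 N) 2 :=
    adelicDescentCuspForm N 2 two_pos (show GL (Fin 2) (AdeleRing (𝓞 ℚ) ℚ) → ℂ from ψ) hleft hright hw1 hs1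
      (fun x _ => hl1 x) hbdd
  have hf : adelicLiftFun N 2 f = (show GL (Fin 2) (AdeleRing (𝓞 ℚ) ℚ) → ℂ from ψ) :=
    adelicLiftFun_adelicDescentCuspForm two_pos hleft hright hw1 hs1 (fun x _ => hl1 x) hbdd
  refine ⟨ψ, hψW, hψ0, hψfix, hw, hL, hZ, f, hf, fun hf0 => hψ0 ?_⟩
  -- `f = 0` would force `ψ = φ_f = 0`
  have h0 : adelicLiftFun N 2 ((0 : CuspForm (Gamma1 N) 2) : ℍ → ℂ) =
      (show GL (Fin 2) (AdeleRing (𝓞 ℚ) ℚ) → ℂ from ψ) := by rw [← hf0]; exact hf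
  funext g
  have hg := congrFun h0 g
  rw [CuspForm.coe_zero, adelicLiftFun, archLift_apply, SlashAction.zero_slash, Pi.zero_apply, zero_mul] at hg
  exact hg.symm

end Plumbing

/-! ## §4  Composition: D4a from `DescentTwo` / `CuspFormOfFixedTwo` / `RigidityTwo`, and `d4a_holds` (kernel-checked, no sorry) -/

/-- **D4a ⇐ DescentTwo (PROVED).** Clean model `π₀` of the weight-zero `π` at `{1/2, -1/2}` (P0,
P0′); the Satake feed `∏ α = 1` cofinitely (P1) gives the even sign (P2′); Casselman's new vector
(`CuspidalAutomorphicRepData.exists_gammaOneFiniteLevel_fixed`, PROVED in the tree); `DescentTwo`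
gives `f ∈ S₂(Γ₁(N))`, `f ≠ 0`, `φ_f ∈ W₀`; P9 the exceptional modulus `R` and
`a_v(E) = a_p(E ⊗ ℚ)`; F5 (descend first, Atkin–Lehner–Li second) the `Γ₀(M₀)`-newform `g` with
`a_p(g) = a_v(E)` off `N R`; D4a with `M = M₀`, exceptional modulus `N R`. -/
theorem D4a_of_descentTwo (hD : DescentTwo) : D4a := by
  intro E hΔ hE
  obtain ⟨hL, π, h0, hH⟩ := hE
  -- P0 + P0′: the clean model at `{1/2, -1/2}`
  obtain ⟨π₀, hbot, hpar₀, hle, hAG, hsat⟩ :=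
    exists_clean_of_hasArchParameter (HasWeightZero.hasArchParameter_weightTwo h0) sOne_add_sTwo
  -- P1 (cofinite) + P2′: even sign on the clean model
  have hfeed : ∀ᶠ v : HeightOneSpectrum (𝓞 ℚ) in cofinite, ∃ α : Multiset ℂ,
      π₀.1.HasSatakeParamAt v α ∧ α.prod = 1 := by
    filter_upwards [eventually_not_mem_asIdeal hΔ, π₀.1.hasSatakeParamAt_cofinite_holds] with v hv hur
    obtain ⟨α, hα⟩ := hur
    exact ⟨α, hα, (satakeFeed_of_hasHeckePolynomialAt hsat (hH v hv) hα).1⟩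
  have hpos : ∀ φ ∈ π₀.1.W, ∀ g, φ (g * Rat.iotaA (rotK Real.pi)) = φ g := fun φ hφ g =>
    apply_mul_iotaA_rotK_pi_eq_self hbot hfeed hφ g
  -- Casselman's new vector (PROVED in the tree)
  obtain ⟨N, hN, φ, hφ, hφ0, hfix⟩ := π₀.exists_gammaOneFiniteLevel_fixed
  -- ARCH(2): the residual
  obtain ⟨f, hf0, hfW⟩ := hD hL π₀ hbot hpar₀ hpos hAG N φ hφ hφ0 hfix
  -- P9: the exceptional modulus and `a_w(E) = a_p(E ⊗ ℚ)`
  obtain ⟨R, hR0, hR⟩ := exists_R_lFunction_eq_frobTraceAt hΔ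
  -- the feed at every `v` with `p_v ∤ R`
  have hfeedR : ∀ v : HeightOneSpectrum (𝓞 ℚ), ¬ natGenerator v ∣ R → ∀ α : Multiset ℂ,
      π₀.1.HasSatakeParamAt v α → α.prod = 1 ∧
        (((Real.sqrt (natGenerator v) : ℝ) : ℂ)) ^ ((2 : ℤ) - 1) * α.sum = ((frobTraceAt E v : ℂ)) :=
    fun v hvR α hα => satakeFeed_of_hasHeckePolynomialAt hsat (hH v (hR v hvR).1) hα
  -- FIN(2): descend first, Atkin–Lehner–Li second
  obtain ⟨M₀, hM₀0, -, g, hg, hcoef⟩ :=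
    exists_isNewform0_of_adelicLiftFunA_mem_k hbot hf0 hfW hR0 (fun v => (frobTraceAt E v : ℂ)) hfeedR
  refine ⟨M₀, hM₀0, g, hg, N * R, ⟨mul_ne_zero hN.out hR0⟩, fun q hq hqMR => ?_⟩
  set v : HeightOneSpectrum (𝓞 ℚ) := (primesEquiv (R := 𝓞 ℚ)).symm ⟨q, hq⟩ with hv
  have hqv : natGenerator v = q :=
    congrArg Subtype.val ((primesEquiv (R := 𝓞 ℚ)).apply_symm_apply ⟨q, hq⟩)
  have hvNR : ¬ natGenerator v ∣ N * R := fun h => hqMR (hqv ▸ dvd_mul_of_dvd_right h M₀)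
  have hvR : ¬ natGenerator v ∣ R := fun h => hvNR (dvd_mul_of_dvd_right h N)
  have h1 := hcoef v hvNR
  obtain ⟨-, h2⟩ := hR v hvR
  rw [hqv] at h1 h2
  rw [h1, h2]

/-- **D4a ⇐ gen-4's P6** (PROVED composition). -/
theorem D4a_of_cuspFormOfFixedTwo (h : CuspFormOfFixedTwo) : D4a :=
  D4a_of_descentTwo (descentTwo_of_cuspFormOfFixedTwo h)

/-- **D4a ⇐ P4 alone (PROVED composition): the residual debt of Plan A is the single rigidity
lemma `RigidityTwo`** (⇐ P4a + P4b of gen 4). -/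
theorem D4a_of_rigidityTwo (h : RigidityTwo) : D4a :=
  D4a_of_cuspFormOfFixedTwo (cuspFormOfFixedTwo_of_rigidityTwo h)

/-- **P4 = `RigidityTwo` HOLDS (PROVED, gen 5).**  A form `ψ ∈ W ≤ 𝒜₀` of weight `0` killed by
`Z`, `X`, `X̄` is killed by every `Y ∈ 𝔤𝔩₂(ℝ)` (`lieDeriv_toLie_eq_zero_of_killed`), hence by the
datum's Lie derivatives `Y ⊗ 1` (`Rat.lieDeriv_ofArch_lieOfReal_eq`), in particular by the
square-zero directions at the real place; a cusp form on `GL₂` so annihilated vanishes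
(`eq_zero_of_mem_cuspFormsGL_of_forall_lieDeriv_realPlace`: the constant-term integrand along
`P₁` is constant by strong approximation, and the cusp condition kills it).  The `K₁(N)`-fixedness
hypothesis is not even used. [cite: BorelJacquet1979, §4.4] [cite: Harder1987, §3.1] -/
theorem rigidityTwo_holds : RigidityTwo := by
  intro hcpt π hcusp N _ ψ hψ _hfix hw0 hZ0 hL0 hR0
  have hs : IsArchSmooth Rat.iotaA ψ := (π.isArchSmooth_of_mem_W hψ).iotaA
  have hall : ∀ X : Matrix (Fin 2) (Fin 2) ℝ, lieDeriv Rat.iotaA (toLie X) ψ = 0 :=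
    lieDeriv_toLie_eq_zero_of_killed hs hw0 hZ0 hL0 hR0
  refine eq_zero_of_mem_cuspFormsGL_of_forall_lieDeriv_realPlace (le_refl 2)
    ⟨Rat.infinitePlace, Rat.isReal_infinitePlace⟩ (hcusp hψ) fun Z _ => ?_
  have e : lieOf (realPlaceLie 2 ⟨Rat.infinitePlace, Rat.isReal_infinitePlace⟩ Z) = Rat.lieOfReal hcpt Z :=
    Subtype.ext (Rat.realPlaceLie_eq_map _ Z)
  rw [e, Rat.lieDeriv_ofArch_lieOfReal_eq]
  exact hall Z

/-- **D4a HOLDS (gen 5, no residual, no sorry): the adelic-to-classical dictionary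
`π(ℓ-adic system, HT {0,-1}, n = 2, ℚ) ↦ (N, weight-2 newform f with a_p(f) = tr ρ(Frob_p))`,
Plan A's only non-named debt, is discharged.**  Consequently gen-3's
`liftFive_congruence_of_FLS2015_theorem2` / `stub_liftFive_of_planA` need only the NAMED facts. -/
theorem d4a_holds : D4a := D4a_of_rigidityTwo rigidityTwo_holds

/-- The other two residual Props of this file hold as well. -/
theorem cuspFormOfFixedTwo_holds : CuspFormOfFixedTwo := cuspFormOfFixedTwo_of_rigidityTwo rigidityTwo_holds

theorem descentTwo_holds : DescentTwo := descentTwo_of_cuspFormOfFixedTwo cuspFormOfFixedTwo_holds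


/-! ## §5  Plan A END TO END with D4a discharged.  Gen-3's A1, D1, D2′ (PROVED in
`STUB_IDEAS_stub_liftFive_2g3.lean`, not importable from here) enter as hypotheses stated
VERBATIM; gen-3's D4 and the two assemblies are copied with `d4a_holds` in place of the sorry. -/

section PlanA

open Literature.NumberTheory.Automorphic.BCDT WeierstrassCurve

/-- The registered signature of `stub_liftFive` (= gen-3 `Sig`). -/
def Sig : Prop :=
  ∀ (W : WeierstrassCurve ℚ) [W.IsElliptic] (ρ : ModPGaloisRep ℚ (ZMod 5) 2),
    W.IsTorsionGaloisRep 5 ρ → ρ.IsAbsIrreducibleOverSqrt 5 → ¬ 25 ∣ W.conductorNorm ℤ →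
    ρ.IsModular → W.IsModularGaloisRepTate 5

/-- **A1** = gen-3 `modPImageAbsIrreducibleOverCyclotomic_five_of_isAbsIrreducibleOverSqrt` (PROVED
there: index-`2` restriction `ℚ(ζ₅) ⊃ ℚ(√5)` + `isAbsolutelyIrreducible_conj`). -/
def A1 : Prop :=
  ∀ (W : WeierstrassCurve ℚ) [W.IsElliptic] (E' : WeierstrassCurve ℚ) (ρ : ModPGaloisRep ℚ (ZMod 5) 2),
    W.IsTorsionGaloisRep 5 ρ → E'.IsTorsionGaloisRep 5 ρ → ρ.IsAbsIrreducibleOverSqrt 5 →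
    ModPImageAbsIrreducibleOverCyclotomic E' 5

/-- **D1** = gen-3 `exists_integralModel` (PROVED there: `hasGlobalMinimalModel_rat_holds`). -/
def D1 : Prop :=
  ∀ (W : WeierstrassCurve ℚ) [W.IsElliptic],
    ∃ (E : WeierstrassCurve (𝓞 ℚ)) (C : VariableChange ℚ),
      C • E.baseChange ℚ = W ∧ E.Δ ≠ 0 ∧
      ∀ (n : ℕ) [Fact n.Prime] (ρ : ModPGaloisRep ℚ (ZMod n) 2),
        W.IsTorsionGaloisRep n ρ → (E.baseChange ℚ).IsTorsionGaloisRep n ρ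

/-- **D2′** = gen-3 `isHilbertModular_of_isModular_curve` (PROVED there: Gelbart's dictionary
`exists_hasWeightZero_satake_of_isNewformOf` + good-reduction Frobenius polynomials). -/
def D2' : Prop :=
  ∀ (W' : WeierstrassCurve ℚ) [W'.IsElliptic] [NeZero (W'.conductorNorm ℤ)], BCDT.IsModular W' →
    ∀ (ρ : ModPGaloisRep ℚ (ZMod 5) 2), W'.IsTorsionGaloisRep 5 ρ → ρ.IsHilbertModular

/-- **D2** (weight-two realisation of an abstractly modular irreducible `ρ̄ : Γ_ℚ → GL₂(𝔽₅)`;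
refined Serre / Edixhoven + Ash–Stevens; after gen 5 the ONLY non-named residual of Plan A for the
stub AS TYPED — the congruence form below does not need it). -/
def WeightTwoRealisationFive : Prop :=
  ∀ ρ : ModPGaloisRep ℚ (ZMod 5) 2, FramedRep.IsAbsolutelyIrreducible ρ → ρ.IsModular →
    ρ.IsHilbertModular

/-- **D2-H0: "`ρ̄` is modular OF WEIGHT TWO"** — `ModPGaloisRep.IsModular` with the weight pinned
to `2` (level arbitrary, exceptional set `q ∣ 5N`). -/
def IsModularOfWeightTwo (ρ : ModPGaloisRep ℚ (ZMod 5) 2) : Prop :=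
  ∃ (N : ℕ) (_ : NeZero N) (f : CuspForm (Gamma1 N) 2) (K : Type) (_ : Field K)
    (_ : TopologicalSpace K) (_ : DiscreteTopology K) (j : ZMod 5 →+* K)
    (ι : coeffCharIntegers f →+* K),
    IsNewform1 f ∧
      IsGaloisRepOfNewform1Int f ι {q | q ∣ N * 5}
        (FramedRep.baseChange j continuous_of_discreteTopology ρ)

/-- **D2-H1 (named fact to vendor; Edixhoven 1997 Thm. 1.12 = tree `diamond1995_refinedSerre`
gives type `(N(ρ̄), k(ρ̄))` with `2 ≤ k(ρ̄) ≤ p² - 1`; Ash–Stevens 1986 Thm. 3.5 / Serre 1987 §3.3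
moves any weight `k ≥ 2` at level `N` prime to `p` to weight `2` at level `Γ₁(Np)`; newform by
Atkin–Lehner–Li).** For irreducible `ρ̄ : Γ_ℚ → GL₂(𝔽₅)`: modular of some weight ⇒ of weight `2`. -/
def AshStevensFive : Prop :=
  ∀ ρ : ModPGaloisRep ℚ (ZMod 5) 2, FramedRep.IsAbsolutelyIrreducible ρ → ρ.IsModular →
    IsModularOfWeightTwo ρ

/-- **D2-H2 (dictionary, provable from the tree: `exists_cuspidalAutomorphicRepData_newform` for the
weight-`2` newform, `map_a_weightZeroInfinityType_two`, and the coefficient subring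
`O = ι⁻¹(j(𝔽₅)) ⊆ 𝓞_f` with `red = j⁻¹ ∘ ι`; template `isHilbertModular_of_isModular_curve`).** -/
def DictionaryWeightTwo : Prop :=
  ∀ ρ : ModPGaloisRep ℚ (ZMod 5) 2, IsModularOfWeightTwo ρ → ρ.IsHilbertModular

/-- D2 ⇐ D2-H1 + D2-H2 (composition). -/
theorem weightTwoRealisationFive_of (h1 : AshStevensFive) (h2 : DictionaryWeightTwo) :
    WeightTwoRealisationFive := fun ρ hirr hmod => h2 ρ (h1 ρ hirr hmod)

/-- **D4 (gen-3, now PROVED outright)**: `D4a` (`d4a_holds`) + Serre 1987 §4.6 in the tree's form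
`isModular_of_isNewform0_of_cuspCoeff_eq_off_of_three_facts` (Faltings discharged by
`isIsogenous_iff_frobeniusTrace_eq_holds`; ES + Carayol granted) + `IsModular.isModularGaloisRepTate`
+ `LFunction_smul`. -/
theorem isModularGaloisRepTate_of_isAutomorphicOfWeightZero (hES : eichlerShimuraConstruction)
    (hC : ∀ (N : ℕ) [NeZero N], IsNewformOf.level_eq_conductorNorm (N := N))
    (E : WeierstrassCurve (𝓞 ℚ)) (W : WeierstrassCurve ℚ) [W.IsElliptic] (C : VariableChange ℚ)
    (hCW : C • E.baseChange ℚ = W) (hΔ : E.Δ ≠ 0) (hE : IsAutomorphicOfWeightZero E) :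
    W.IsModularGaloisRepTate 5 := by
  haveI : NeZero (W.conductorNorm ℤ) := ⟨(conductorNorm_pos_holds W).ne'⟩
  haveI : Fact (Nat.Prime 5) := ⟨by norm_num⟩
  haveI : (E.baseChange ℚ).IsElliptic := by
    rw [WeierstrassCurve.isElliptic_iff, WeierstrassCurve.baseChange, WeierstrassCurve.map_Δ,
      isUnit_iff_ne_zero]
    exact (map_ne_zero_iff _ (IsFractionRing.injective (𝓞 ℚ) ℚ)).2 hΔ
  obtain ⟨M, _, g, hg, R, _, h⟩ := d4a_holds E hΔ hE
  have hLW : W.LFunction = (E.baseChange ℚ).LFunction := by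
    rw [← hCW, WeierstrassCurve.LFunction_smul]
  have h' : ∀ q : ℕ, q.Prime → ¬ q ∣ M * R → cuspCoeff g q = (W.LFunction q : ℂ) := by
    intro q hq hqMR
    rw [hLW]
    exact h q hq hqMR
  exact (isModular_of_isNewform0_of_cuspCoeff_eq_off_of_three_facts hES
    isIsogenous_iff_frobeniusTrace_eq_holds hC W hg h').isModularGaloisRepTate 5

/-- **Plan A, CONGRUENCE form — what case B of `isModular_freyCurve_of_stubs` actually has
(`E[5] ≅ E′[5]` with `E′` a modular CURVE from the `3`–`5` switch): after gen 5 its trust base is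
{`FLS2015_theorem2`, ES, Carayol} and NOTHING ELSE (A1, D1, D2′ proved in gen 3, D4a here).** -/
theorem liftFive_congruence_of_FLS2015_theorem2 (hFLS : FLS2015_theorem2)
    (hES : eichlerShimuraConstruction)
    (hC : ∀ (N : ℕ) [NeZero N], IsNewformOf.level_eq_conductorNorm (N := N))
    (hA1 : A1) (hD1 : D1) (hD2' : D2')
    (W : WeierstrassCurve ℚ) [W.IsElliptic] (W' : WeierstrassCurve ℚ) [W'.IsElliptic]
    [NeZero (W'.conductorNorm ℤ)] (ρ : ModPGaloisRep ℚ (ZMod 5) 2)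
    (hρ : W.IsTorsionGaloisRep 5 ρ) (hρW' : W'.IsTorsionGaloisRep 5 ρ)
    (hirr : ρ.IsAbsIrreducibleOverSqrt 5) (hW' : BCDT.IsModular W') :
    W.IsModularGaloisRepTate 5 := by
  haveI : Fact (Nat.Prime 5) := ⟨by norm_num⟩
  obtain ⟨E, C, hCW, hΔ, htors⟩ := hD1 W
  have hρE : (E.baseChange ℚ).IsTorsionGaloisRep 5 ρ := htors 5 ρ hρ
  have himg : ModPImageAbsIrreducibleOverCyclotomic (E.baseChange ℚ) 5 :=
    hA1 W (E.baseChange ℚ) ρ hρ hρE hirr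
  have hmod₀ : ρ.IsHilbertModular := hD2' W' hW' ρ hρW'
  exact isModularGaloisRepTate_of_isAutomorphicOfWeightZero hES hC E W C hCW hΔ
    (hFLS.of_exists ℚ E hΔ 5 (by decide) ⟨ρ, hρE, hmod₀⟩ himg)

/-- **Plan A for the stub AS TYPED**: trust base {`FLS2015_theorem2`, ES, Carayol} + the one
residual D2 (`WeightTwoRealisationFive`); `25 ∤ N` unused. -/
theorem sig_of_planA (hFLS : FLS2015_theorem2) (hES : eichlerShimuraConstruction)
    (hC : ∀ (N : ℕ) [NeZero N], IsNewformOf.level_eq_conductorNorm (N := N))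
    (hA1 : A1) (hD1 : D1) (hD2 : WeightTwoRealisationFive) : Sig := by
  intro W _ ρ hρ hirr _h25 hmod
  haveI : Fact (Nat.Prime 5) := ⟨by norm_num⟩
  obtain ⟨E, C, hCW, hΔ, htors⟩ := hD1 W
  have hρE : (E.baseChange ℚ).IsTorsionGaloisRep 5 ρ := htors 5 ρ hρ
  have himg : ModPImageAbsIrreducibleOverCyclotomic (E.baseChange ℚ) 5 :=
    hA1 W (E.baseChange ℚ) ρ hρ hρE hirr
  exact isModularGaloisRepTate_of_isAutomorphicOfWeightZero hES hC E W C hCW hΔ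
    (hFLS.of_exists ℚ E hΔ 5 (by decide) ⟨ρ, hρE, hD2 ρ hirr.isAbsolutelyIrreducible hmod⟩ himg)

end PlanA

/-! ## §6  Sanity: the `k = 1` instances are the tree's theorems (statement-level cross-check) -/

section Sanity

variable {hcpt : isCompact_glFiniteIntegralLevel 2 ℚ} {π : AutomorphicRepData (AutomorphyDatum.gl 2 ℚ hcpt)}
  {N : ℕ} [NeZero N]

/-- At `k = 1` the factor `(√p)^{k-1}` is `1`: F3′ specialises to the tree's weight-one dictionary
`Σα = a_p`, `∏α = e` (`hasSatakeParamAt_of_adelicLiftFunA_mem`). -/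
example (hbot : π.W' = ⊥) {f : CuspForm (Gamma1 N) 1} (hf0 : f ≠ 0) (hfW : adelicLiftFunA N 1 f ∈ π.W)
    {v : HeightOneSpectrum (𝓞 ℚ)} (hv : ¬ v.asIdeal ∣ Ideal.span {(N : 𝓞 ℚ)}) {a e : ℂ}
    (hT : ModularForms.heckeT (Gamma1 N) 1 (natGenerator v) f = a • f)
    (hD : diamondOp N 1 ((natGenerator v : ℕ) : ZMod N) f = e • f) :
    ∃ α : Multiset ℂ, π.HasSatakeParamAt v α ∧ α.sum = a ∧ α.prod = e := by
  obtain ⟨α, hα, hsum, hprod⟩ := hasSatakeParamAt_sum_prod_of_adelicLiftFunA_mem_k hbot hf0 hfW hv hT hD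
  refine ⟨α, hα, ?_, hprod⟩
  rwa [show ((1 : ℤ) - 1) = 0 by norm_num, zpow_zero, one_mul] at hsum

end Sanity

end Summit.ABC.ABC.Cruxes.FreyModularity.StubIdeas.LiftFive2g5

end
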